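import Literature.NumberTheory.Automorphic.ShimuraCurveRibetTakahashiPeterssonTwoPowerLevelProofs
import HarnessLib

/-!
# Mai–Murty's bound `(f, f) ≪ N (log N)³` at the levels `16M` and `32M`: the cusps of `Γ₀(2ᵗM)`
# with quarter-integer translations see the newform of the twist `E^{(−1)}`

Topic `NumberTheory/Automorphic`; namespace `Literature.NumberTheory.Automorphic`. A proofs-only file
(theorems only; D-0026) completing, for the Frey–Hellegouarch class, the work on the named fact
`murty_petersson_newform_upper_bound` of `ShimuraCurveRibetTakahashi.lean` (`‖f‖² ≪ N log N`,
H. Pasten, *Shimura curves and the abc conjecture*, arXiv:1705.09251, §16 p. 49, from [MaiMurty1994]):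
the statement the cited proof establishes — `(f, f) ≪ N (log N)³` (Mai–Murty 1994, §2) — is in the
tree for squarefree `N` (`…PeterssonConvexityCubeProofs.lean`), for `N = 2ᵗM` with `t ≤ 3` and `M` odd
squarefree (`…PeterssonTwoPowerLevelProofs.lean`: the Fourier expansions of `f` at all cusps of
`Γ₀(2ᵗM)` are dilates of `f` as long as the cusp `k/2^{min(j,t−j)}`-translations are half-integers),
and for `16 ∣ N` twisted from such levels (`…PeterssonTwistComparisonProofs.lean`). Here `t ∈ {4, 5}`:
the cusps of type `min(j, t−j) = 2` require QUARTER translates of `f`, and for the newform `f` of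
`E/ℚ` (`4 ∣ N`, so `a_{2n}(f) = 0`) these are the newform `g` of the twist `E^{(−1)}`:

* §1 `IsNewformOf.apply_quarter_vadd`: **`f(τ + 1/4) = i · g(τ)`** (and `f(τ + 3/4) = −i · g(τ)`) when
  `4 ∣ N`, `4 ∣ N'` — from `aₙ(g) = χ₄(n) aₙ(f)` for odd `n`
  (`IsNewformOf.cuspCoeff_quadraticTwist_neg_one_of_odd`), `a_{2n} = 0` for both, and
  `e(n/4) = i χ₄(n)`; hence `f ∣ (1 u/4; 0 1) = ±i · g` (`exists_slash_translGL_quarter`) and, at the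
  same level, **`f ∣ L(c) = θ · g`, `|θ| = 1`, whenever `4c/N` is odd**
  (`IsNewformOf.exists_slash_lowerSL_of_quarter`: `L(c) = w_N (1 −c/N; 0 1) w_N⁻¹`, `g ∣ w_N = ±g`).
* §2 `exists_slash_rep_of_le_two`, `exists_slash_rep_of_lt_two`: for the representatives `cuspRep`
  of `…TwoPowerLevelProofs.lean` of the types with `min(j, t−j) = 2`,
  **`(f ∣ cuspRep)(τ) = K · g((D/N)τ + r)`, `|K| = D/N`**.
* §3 `IsNewformOf.rsCoeff_eq_of_two_pow_mul_five`: since `|aₙ(g)| = |aₙ(f)|` for all `n`, the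
  Rankin–Selberg trace coefficients at level `2ᵗM`, `2 ≤ t ≤ 5`, are the SAME dilate-sum
  `Σ_{m∣M} Σ_{j≤t} #kSet·width·𝟙[D∣n](D/N)²|a_{n/D}(f)|²` as for `t ≤ 3`; `|A_t(s)| ≤ 12`
  (`norm_twoFactor_le_twelve`).
* §4 **`exists_petersson_le_mul_log_cube_of_two_pow_mul_five`**: an absolute `C` with
  `Re (f, f)_{Γ₀(2ᵗM)} ≤ C·N·(1 + log N)³` for `2 ≤ t ≤ 5`, `M` odd squarefree, all `E/ℚ` with newforms
  `f` of `E` and `g` of `E^{(−1)}` at level `2ᵗM` (the Phragmén–Lindelöf assembly of the squarefree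
  case verbatim); the combined **`exists_petersson_le_mul_log_cube_of_not_sixtyfour_dvd`**: every `N`
  with `64 ∤ N` and squarefree odd part, given the newform `g` of `E^{(−1)}` at a level `N'` with
  `16 ∤ N'` or `N' = N` when `16 ∣ N` — in particular every Frey–Hellegouarch curve
  (`v₂(N) ∈ {0, 1, 3, 4, 5}`; `2⁴ ∥ N` exactly when the sign-swapped model `E^{(−1)}` is semistable at
  `2`, and `2⁵ ∥ N` is stable under the twist); and the power forms `…_rpow_…` (`≤ C·N^{1+ε}/ε³`).
* §5 `level_dvd_lcm_sq_of_charTwist_packet` (**`N ∣ lcm(M, m²)`** for a newform of level `M` carrying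
  the `ψ`-twisted packet of a newform of level `N`, `ψ mod m` primitive quadratic — Atkin–Li; the
  tree's `level_dvd_mul_sq_of_charTwist_packet` at the common multiple `lcm(M, m²)` instead of
  `M m²`), hence `IsNewformOf.level_dvd_lcm_sixteen_of_quadraticTwist_neg_one` (`N ∣ lcm(N', 16)`,
  `N' ∣ lcm(N, 16)`) and `IsNewformOf.not_sixteen_dvd_or_level_eq_of_quadraticTwist_neg_one`: the
  level hypothesis above is a theorem, giving the unconditional-in-`N'` forms
  **`exists_petersson_le_mul_log_cube_of_not_sixtyfour_dvd'`**, `…_rpow_…'` and the logarithmic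
  form `exists_log_petersson_le_of_not_sixtyfour_dvd` (Pasten's `2 log ‖f‖ ≤ log N + O(log log N)`).

## References

* [MaiMurty1994] L. Mai, M. R. Murty, *The Phragmén–Lindelöf theorem and modular elliptic curves*,
  Contemp. Math. 166 (1994), §2 (Proposition: `log (f,f) = O(log N)`, via `L(1, Sym² f) = O((log N)³)`).
* [AtkinLehner1970] A. O. L. Atkin, J. Lehner, *Hecke operators on `Γ₀(m)`*, Math. Ann. 185 (1970),
  Thm. 3.
* [AtkinLi1978] A. O. L. Atkin, W.-C. W. Li, *Twists of newforms and pseudo-eigenvalues of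
  `W`-operators*, Invent. Math. 48 (1978), §3.
* [DiamondShurman2005] F. Diamond, J. Shurman, *A first course in modular forms*, GTM 228, §3.8, §5.5.
* [Rankin1939] R. A. Rankin, *Contributions to the theory of Ramanujan's function `τ(n)` II*,
  Proc. Cambridge Philos. Soc. 35 (1939), §4.
* [PastenShimura2024] H. Pasten, *Shimura curves and the abc conjecture*, J. Number Theory 254 (2024)
  = arXiv:1705.09251, §16 p. 49.
-/

noncomputable section

open scoped MatrixGroups ModularForm
open Matrix.SpecialLinearGroup Complex ModularForm CongruenceSubgroup
open UpperHalfPlane hiding I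
open Literature.NumberTheory.EllipticCurves.ModularForms

namespace Literature.NumberTheory.Automorphic

/-! ### 1. Quarter translates: `f(τ + 1/4) = i · g(τ)` for the newforms `f`, `g` of `E`, `E^{(−1)}` -/

section Quarter

variable {N N' : ℕ} [NeZero N] [NeZero N'] {W : WeierstrassCurve ℚ} [W.IsElliptic]

/-- `e(n/4) = i · χ₄(n)` for odd `n`. [folklore] -/
theorem exp_two_pi_I_mul_quarter_of_odd {n : ℕ} (hn : ¬ 2 ∣ n) :
    Complex.exp (2 * Real.pi * Complex.I * n * ((((1 / 4 : ℚ) : ℝ)) : ℂ)) =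
      Complex.I * ((ZMod.χ₄ n : ℤ) : ℂ) := by
  rw [ZMod.χ₄_nat_eq_if_mod_four, if_neg (by omega)]
  obtain ⟨w, hw⟩ : ∃ w, n = 4 * w + n % 4 := ⟨n / 4, (Nat.div_add_mod n 4).symm⟩
  have h4 : n % 4 = 1 ∨ n % 4 = 3 := by omega
  rcases h4 with h | h
  · rw [if_pos h]
    rw [h] at hw
    have e : 2 * Real.pi * Complex.I * n * ((((1 / 4 : ℚ) : ℝ)) : ℂ) =
        (w : ℕ) * (2 * Real.pi * Complex.I) + Real.pi / 2 * Complex.I := by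
      rw [hw]; push_cast; ring
    rw [e, Complex.exp_add, Complex.exp_nat_mul, Complex.exp_two_pi_mul_I, one_pow, one_mul,
      Complex.exp_pi_div_two_mul_I]
    simp
  · rw [if_neg (by omega)]
    rw [h] at hw
    have e : 2 * Real.pi * Complex.I * n * ((((1 / 4 : ℚ) : ℝ)) : ℂ) =
        (w : ℕ) * (2 * Real.pi * Complex.I) + Real.pi * Complex.I + Real.pi / 2 * Complex.I := by
      rw [hw]; push_cast; ring
    rw [e, Complex.exp_add, Complex.exp_add, Complex.exp_nat_mul, Complex.exp_two_pi_mul_I, one_pow,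
      one_mul, Complex.exp_pi_mul_I, Complex.exp_pi_div_two_mul_I]
    simp

/-- **`f(τ + 1/4) = i · g(τ)`** for the newform `f` of `E` at a level `4 ∣ N` and the newform `g` of
`E^{(−1)}` at a level `4 ∣ N'`: both have vanishing even-indexed coefficients, `aₙ(g) = χ₄(n)aₙ(f)`
for odd `n`, and `e(n/4) = iχ₄(n)`. [folklore] -/
theorem _root_.Literature.NumberTheory.EllipticCurves.ModularForms.IsNewformOf.apply_quarter_vadd
    {f : CuspForm (Gamma0 N) 2} {g : CuspForm (Gamma0 N') 2} (hf : IsNewformOf W f)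
    (hg : IsNewformOf (W.quadraticTwist (-1)) g) (h4 : 4 ∣ N) (h4' : 4 ∣ N') (τ : ℍ) :
    f (((1 / 4 : ℚ) : ℝ) +ᵥ τ) = Complex.I * g τ := by
  have h1 := hasSum_cuspCoeff_exp f (((1 / 4 : ℚ) : ℝ) +ᵥ τ)
  have h2 := (hasSum_cuspCoeff_exp g τ).mul_left Complex.I
  refine HasSum.unique ?_ h2
  refine h1.congr_fun fun n ↦ ?_
  by_cases hn : 2 ∣ n
  · rw [IsNewform0.cuspCoeff_eq_zero_of_two_dvd hf.1 h4 hn, IsNewform0.cuspCoeff_eq_zero_of_two_dvd hg.1 h4' hn]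
    simp
  · rw [UpperHalfPlane.coe_vadd, IsNewformOf.cuspCoeff_quadraticTwist_neg_one_of_odd hf hg hn]
    have he : Complex.exp (2 * Real.pi * Complex.I * n * (((((1 / 4 : ℚ) : ℝ)) : ℂ) + (τ : ℂ))) =
        Complex.I * ((ZMod.χ₄ n : ℤ) : ℂ) * Complex.exp (2 * Real.pi * Complex.I * n * (τ : ℂ)) := by
      rw [mul_add, Complex.exp_add, exp_two_pi_I_mul_quarter_of_odd hn]
    rw [he]
    ring

/-- **`f(τ + 3/4) = −i · g(τ)`** likewise (`3/4 = 1/4 + 1/2` and `g(τ + 1/2) = −g(τ)`). [folklore] -/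
theorem _root_.Literature.NumberTheory.EllipticCurves.ModularForms.IsNewformOf.apply_three_quarter_vadd
    {f : CuspForm (Gamma0 N) 2} {g : CuspForm (Gamma0 N') 2} (hf : IsNewformOf W f)
    (hg : IsNewformOf (W.quadraticTwist (-1)) g) (h4 : 4 ∣ N) (h4' : 4 ∣ N') (τ : ℍ) :
    f (((3 / 4 : ℚ) : ℝ) +ᵥ τ) = -Complex.I * g τ := by
  have hx : (((3 / 4 : ℚ) : ℝ)) = (((1 / 4 : ℚ) : ℝ)) + (((1 / 2 : ℚ) : ℝ)) := by push_cast; norm_num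
  rw [hx, add_vadd, hf.apply_quarter_vadd hg h4 h4', hg.1.apply_half_vadd h4']
  ring

/-- **`f ∣[2] (1 u/4; 0 1) = θ · g`, `θ = ±i`**, for odd `u`. [folklore] -/
theorem _root_.Literature.NumberTheory.EllipticCurves.ModularForms.IsNewformOf.exists_slash_translGL_quarter
    {f : CuspForm (Gamma0 N) 2} {g : CuspForm (Gamma0 N') 2} (hf : IsNewformOf W f)
    (hg : IsNewformOf (W.quadraticTwist (-1)) g) (h4 : 4 ∣ N) (h4' : 4 ∣ N') {u : ℤ} (hu : Odd u) :
    ∃ θ : ℂ, (θ = Complex.I ∨ θ = -Complex.I) ∧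
      (⇑f : ℍ → ℂ) ∣[(2 : ℤ)] glCast (translGL ((u : ℚ) / 4) : GL (Fin 2) ℚ) = θ • (⇑g : ℍ → ℂ) := by
  -- `u = 4w + 1` or `4w + 3`
  have hu4 : u % 4 = 1 ∨ u % 4 = 3 := by
    have := Int.odd_iff.mp hu; omega
  obtain ⟨w, hw⟩ : ∃ w : ℤ, u = 4 * w + u % 4 := ⟨u / 4, by omega⟩
  rcases hu4 with h | h
  · refine ⟨Complex.I, Or.inl rfl, ?_⟩
    ext τ
    rw [slash_translGL_apply, Pi.smul_apply, smul_eq_mul]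
    have hx : ((((u : ℚ) / 4 : ℚ)) : ℝ) = (w : ℝ) + (((1 / 4 : ℚ)) : ℝ) := by
      rw [hw, h]; push_cast; ring
    rw [hx, add_vadd, apply_intCast_vadd f w]
    exact hf.apply_quarter_vadd hg h4 h4' τ
  · refine ⟨-Complex.I, Or.inr rfl, ?_⟩
    ext τ
    rw [slash_translGL_apply, Pi.smul_apply, smul_eq_mul]
    have hx : ((((u : ℚ) / 4 : ℚ)) : ℝ) = (w : ℝ) + (((3 / 4 : ℚ)) : ℝ) := by
      rw [hw, h]; push_cast; ring
    rw [hx, add_vadd, apply_intCast_vadd f w]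
    exact hf.apply_three_quarter_vadd hg h4 h4' τ

/-- **`f ∣[2] L(c) = θ · g`, `|θ| = 1`, when `4c/N` is an odd integer** (`f`, `g` the newforms of
`E`, `E^{(−1)}` at the SAME level `N`, `4 ∣ N`): `f ∣ L(c) = ε_f (f ∣ T^{−c/N}) ∣ w_N`, the quarter
translate is `±i·g`, and `g ∣ w_N = ε_g g`. [cite: AtkinLehner1970, Thm. 3] -/
theorem _root_.Literature.NumberTheory.EllipticCurves.ModularForms.IsNewformOf.exists_slash_lowerSL_of_quarter
    {f g : CuspForm (Gamma0 N) 2} (hf : IsNewformOf W f) (hg : IsNewformOf (W.quadraticTwist (-1)) g)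
    (h4 : 4 ∣ N) {c u : ℤ} (hu : Odd u) (h : 4 * c = u * N) :
    ∃ θ : ℂ, ‖θ‖ = 1 ∧
      (⇑f : ℍ → ℂ) ∣[(2 : ℤ)] (mapGL ℝ (lowerSL c) : GL (Fin 2) ℝ) = θ • (⇑g : ℍ → ℂ) := by
  obtain ⟨ε, hε, hW, hL⟩ := hf.1.exists_slash_lowerSL
  obtain ⟨ε', hε', hW'⟩ := hg.1.exists_slash_frickeGL_eq_smul
  have hN0 : (N : ℚ) ≠ 0 := by exact_mod_cast NeZero.ne N
  have hq : (-(c : ℚ) / N : ℚ) = ((-u : ℤ) : ℚ) / 4 := by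
    have h' : (4 : ℚ) * c = u * N := by exact_mod_cast h
    field_simp
    push_cast
    linarith
  obtain ⟨θ, hθ, hT⟩ := hf.exists_slash_translGL_quarter hg h4 h4 hu.neg
  refine ⟨ε * (θ * ε'), ?_, ?_⟩
  · have h1 : ‖ε‖ = 1 := by rcases hε with rfl | rfl <;> simp
    have h2 : ‖θ‖ = 1 := by rcases hθ with rfl | rfl <;> simp
    have h3 : ‖ε'‖ = 1 := by rcases hε' with rfl | rfl <;> simp
    rw [norm_mul, norm_mul, h1, h2, h3, one_mul, one_mul]
  · rw [hL c, hq, hT, ModularForm.smul_slash, σ_glCast, hW', smul_smul, smul_smul, mul_assoc]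

end Quarter

/-! ### 2. The slash of `f` by the representatives of the types with `min(j, t−j) = 2`: dilates of `g` -/

section TypesTwo

variable {t M : ℕ} [NeZero M] {W : WeierstrassCurve ℚ} [W.IsElliptic]

/-- **The slash of `f` by a family-1 representative with `j = t − 2`** (`t ≥ 4`; the translation
`k/4` is a quarter-integer): `(f ∣ β(Q)L(2ʲmk))(τ) = (θ ε_Q/Q) g(τ/Q)`, `Q = M/m`, `|θ| = 1`.
[cite: AtkinLehner1970, Thm. 3] -/
theorem exists_slash_rep_of_le_two (hMo : Odd M) (hMs : Squarefree M) {m j k : ℕ} (hm : m ∣ M)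
    (hj2 : j + 2 = t) (htj : t ≤ 2 * j) (hk : Odd k)
    {f g : CuspForm (Gamma0 (2 ^ t * M)) 2} (hf : IsNewformOf W f)
    (hg : IsNewformOf (W.quadraticTwist (-1)) g) :
    ∃ K : ℂ, ‖K‖ = (cuspRepDil t m j : ℝ) / (2 ^ t * M : ℕ) ∧ ∃ r : ℝ, ∀ τ : ℍ,
      ((⇑f : ℍ → ℂ) ∣[(2 : ℤ)] (mapGL ℝ (cuspRep t M m j k) : GL (Fin 2) ℝ)) τ =
        K * g (UpperHalfPlane.mk (((cuspRepDil t m j : ℕ) : ℂ) / ((2 ^ t * M : ℕ) : ℕ) * τ + r)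
          (im_dilate_pos (dil_pos j (pos_of_dvd hm)) r τ)) := by
  have hj : j ≤ t := by omega
  obtain ⟨hm0, hmo, hQo, hcop, hMeq, hNeq⟩ := type_arith t hMo hMs hm
  set Q := M / m with hQdef
  have hQ0 : 0 < Q := Nat.pos_of_ne_zero fun h ↦ by simp [h] at hQo
  haveI : NeZero Q := ⟨hQ0.ne'⟩
  have hQN : Q ∣ 2 ^ t * M := ⟨2 ^ t * m, by rw [hNeq]; ring⟩
  have hNQ : 2 ^ t * M / Q = 2 ^ t * m := by
    rw [hNeq, Nat.mul_div_cancel _ hQ0]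
  have hc : Nat.Coprime Q (2 ^ t * M / Q) := by
    rw [hNQ]
    exact Nat.Coprime.mul_right ((Nat.coprime_two_right.mpr hQo).pow_right t) hcop
  obtain ⟨ε, hε, hAL⟩ := hf.1.exists_slash_atkinLehnerSL_mul hQN hc
  -- the slash by `L(Q c) = L(2ʲ M k)`, `4 Q c = k N`: `θ • g`
  have hθ : ∃ θ : ℂ, ‖θ‖ = 1 ∧
      (⇑f : ℍ → ℂ) ∣[(2 : ℤ)] (mapGL ℝ (lowerSL ((Q : ℤ) * ((2 ^ j * m * k : ℕ) : ℤ))) : GL (Fin 2) ℝ) =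
        θ • (⇑g : ℍ → ℂ) := by
    refine hf.exists_slash_lowerSL_of_quarter hg (four_dvd_of_two_le (by omega)) (u := k)
      (by exact_mod_cast hk) ?_
    rw [hMeq, ← hj2, pow_add]
    push_cast
    ring
  obtain ⟨θ, hθn, hθ⟩ := hθ
  have hm' : (0 : ℝ) < m := by exact_mod_cast hm0
  have hQr : (0 : ℝ) < Q := by exact_mod_cast hQ0
  refine ⟨ε * θ / Q, ?_, 0, fun τ ↦ ?_⟩
  · have hε1 : ‖ε‖ = 1 := by rcases hε with rfl | rfl <;> simp
    rw [norm_div, norm_mul, hε1, hθn, Complex.norm_natCast, one_mul]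
    simp only [cuspRepDil, if_pos htj]
    rw [hNeq]
    push_cast
    field_simp
  · rw [cuspRep, if_pos htj, hAL, tpDinv_mul_mapGL_lowerSL, SlashAction.slash_mul, hθ,
      ModularForm.smul_slash, σ_glCast, Pi.smul_apply, Pi.smul_apply, slash_upperGL_apply,
      smul_eq_mul, smul_eq_mul]
    have hpt : UpperHalfPlane.mk (((((Q : ℚ)⁻¹ : ℚ) : ℂ) * τ + ((0 : ℚ) : ℂ)) / ((1 : ℚ) : ℂ))
        (im_upperGL_pos (by positivity) one_pos 0 τ) =
        UpperHalfPlane.mk (((cuspRepDil t m j : ℕ) : ℂ) / ((2 ^ t * M : ℕ) : ℕ) * τ + ((0 : ℝ) : ℂ))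
          (im_dilate_pos (dil_pos j (pos_of_dvd hm)) (0 : ℝ) τ) := by
      refine UpperHalfPlane.ext ?_
      show ((((Q : ℚ)⁻¹ : ℚ) : ℂ) * τ + ((0 : ℚ) : ℂ)) / ((1 : ℚ) : ℂ) =
        ((cuspRepDil t m j : ℕ) : ℂ) / ((2 ^ t * M : ℕ) : ℕ) * τ + ((0 : ℝ) : ℂ)
      simp only [cuspRepDil, if_pos htj]
      rw [hNeq]
      have hQc : (Q : ℂ) ≠ 0 := by exact_mod_cast hQ0.ne'
      have hmc : (m : ℂ) ≠ 0 := by exact_mod_cast hm0.ne'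
      push_cast
      field_simp
    rw [hpt]
    have hQc : (Q : ℂ) ≠ 0 := by exact_mod_cast hQ0.ne'
    push_cast
    field_simp

/-- **The slash of `f` by a family-2 representative with `j = 2 < t − 2`** (`t ≥ 5`):
`(f ∣ β(2ᵗQ) Y(2, mk))(τ) = θ ε (4/R) g((4/R)τ + r₀)`, `R = 2^{t−2} Q`. [cite: AtkinLehner1970, Thm. 3] -/
theorem exists_slash_rep_of_lt_two (hMo : Odd M) (hMs : Squarefree M) {m j k : ℕ} (hm : m ∣ M)
    (htj : 2 * j < t) (hj2 : j = 2) (hk : Odd k)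
    {f g : CuspForm (Gamma0 (2 ^ t * M)) 2} (hf : IsNewformOf W f)
    (hg : IsNewformOf (W.quadraticTwist (-1)) g) :
    ∃ K : ℂ, ‖K‖ = (cuspRepDil t m j : ℝ) / (2 ^ t * M : ℕ) ∧ ∃ r : ℝ, ∀ τ : ℍ,
      ((⇑f : ℍ → ℂ) ∣[(2 : ℤ)] (mapGL ℝ (cuspRep t M m j k) : GL (Fin 2) ℝ)) τ =
        K * g (UpperHalfPlane.mk (((cuspRepDil t m j : ℕ) : ℂ) / ((2 ^ t * M : ℕ) : ℕ) * τ + r)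
          (im_dilate_pos (dil_pos j (pos_of_dvd hm)) r τ)) := by
  obtain ⟨hm0, hmo, hQo, hcop, hMeq, hNeq⟩ := type_arith t hMo hMs hm
  have hjt : j ≤ t := by omega
  have htj' : ¬ t ≤ 2 * j := by omega
  set Q := M / m with hQdef
  have hQ0 : 0 < Q := Nat.pos_of_ne_zero fun h ↦ by simp [h] at hQo
  haveI : NeZero Q := ⟨hQ0.ne'⟩
  -- `Q' = 2ᵗ Q = P R`, `P = 2ʲ`, `R = 2^{t-j} Q`
  set P : ℕ := 2 ^ j with hPdef
  set R : ℕ := 2 ^ (t - j) * Q with hRdef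
  haveI : NeZero P := ⟨pow_ne_zero j two_ne_zero⟩
  haveI : NeZero R := ⟨mul_ne_zero (pow_ne_zero _ two_ne_zero) hQ0.ne'⟩
  haveI : NeZero (2 ^ t * Q) := ⟨mul_ne_zero (pow_ne_zero _ two_ne_zero) hQ0.ne'⟩
  have hPR : 2 ^ t * Q = P * R := by
    rw [hPdef, hRdef, ← mul_assoc, ← pow_add, Nat.add_sub_cancel' hjt]
  have hQN : 2 ^ t * Q ∣ 2 ^ t * M := ⟨m, by rw [hNeq]; ring⟩
  have hNQ : 2 ^ t * M / (2 ^ t * Q) = m := by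
    rw [hNeq, show 2 ^ t * m * Q = m * (2 ^ t * Q) by ring, Nat.mul_div_cancel _ (NeZero.pos _)]
  have hc : Nat.Coprime (2 ^ t * Q) (2 ^ t * M / (2 ^ t * Q)) := by
    rw [hNQ]
    exact Nat.Coprime.mul_left ((Nat.coprime_two_left.mpr hmo).pow_left t) hcop
  obtain ⟨ε, hε, hAL⟩ := hf.1.exists_slash_atkinLehnerSL_mul hQN hc
  -- the matrix `Y`
  have ha : Odd (((m * k : ℕ)) : ℤ) := by exact_mod_cast hmo.mul hk
  obtain ⟨hY00, hY01, hY10, hY11⟩ := ySL_apply (j := j) ha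
  have hY00' : (ySL j ((m * k : ℕ) : ℤ)) 0 0 = (P : ℤ) := by rw [hY00, hPdef]; push_cast; ring
  -- the slash by `L(R a) = L(2^{t-2} M k)`, `4 R a = k N`: `θ • g`
  have hθ : ∃ θ : ℂ, ‖θ‖ = 1 ∧
      (⇑f : ℍ → ℂ) ∣[(2 : ℤ)] (mapGL ℝ (lowerSL ((R : ℤ) * (ySL j ((m * k : ℕ) : ℤ)) 1 0)) : GL (Fin 2) ℝ) =
        θ • (⇑g : ℍ → ℂ) := by
    rw [hY10]
    refine hf.exists_slash_lowerSL_of_quarter hg (four_dvd_of_two_le (by omega)) (u := k)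
      (by exact_mod_cast hk) ?_
    rw [hRdef, hMeq, hj2, show t = (t - 2) + 2 by omega, pow_add, Nat.add_sub_cancel]
    push_cast
    ring
  obtain ⟨θ, hθn, hθ⟩ := hθ
  have hm' : (0 : ℝ) < m := by exact_mod_cast hm0
  have hQr : (0 : ℝ) < Q := by exact_mod_cast hQ0
  refine ⟨ε * θ * P / R, ?_, (P : ℝ) * (qInv j ((m * k : ℕ) : ℤ) : ℝ) / (2 ^ t * Q : ℕ), fun τ ↦ ?_⟩
  · have hε1 : ‖ε‖ = 1 := by rcases hε with rfl | rfl <;> simp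
    rw [norm_div, norm_mul, norm_mul, hε1, hθn, Complex.norm_natCast, Complex.norm_natCast, one_mul,
      one_mul]
    simp only [cuspRepDil, if_neg htj']
    rw [hNeq, hRdef, hPdef, show t = (t - j) + j by omega, pow_add, Nat.add_sub_cancel]
    push_cast
    field_simp
    ring
  · rw [cuspRep, if_neg htj', hAL, tpDinv_mul_mapGL_of_apply P R (2 ^ t * Q) hPR _ hY00',
      SlashAction.slash_mul, hθ, ModularForm.smul_slash, σ_glCast, Pi.smul_apply, Pi.smul_apply,
      slash_upperGL_apply, smul_eq_mul, smul_eq_mul]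
    have hpt : UpperHalfPlane.mk (((((R : ℚ)⁻¹ : ℚ) : ℂ) * τ +
          ((((ySL j ((m * k : ℕ) : ℤ)) 0 1 : ℚ) / (2 ^ t * Q : ℕ) : ℚ) : ℂ)) / (((P : ℚ)⁻¹ : ℚ) : ℂ))
        (im_upperGL_pos (by positivity) (by positivity) _ τ) =
        UpperHalfPlane.mk (((cuspRepDil t m j : ℕ) : ℂ) / ((2 ^ t * M : ℕ) : ℕ) * τ +
          (((P : ℝ) * (qInv j ((m * k : ℕ) : ℤ) : ℝ) / (2 ^ t * Q : ℕ) : ℝ) : ℂ))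
          (im_dilate_pos (dil_pos j (pos_of_dvd hm)) _ τ) := by
      refine UpperHalfPlane.ext ?_
      show ((((R : ℚ)⁻¹ : ℚ) : ℂ) * τ +
          ((((ySL j ((m * k : ℕ) : ℤ)) 0 1 : ℚ) / (2 ^ t * Q : ℕ) : ℚ) : ℂ)) / (((P : ℚ)⁻¹ : ℚ) : ℂ) =
        ((cuspRepDil t m j : ℕ) : ℂ) / ((2 ^ t * M : ℕ) : ℕ) * τ +
          (((P : ℝ) * (qInv j ((m * k : ℕ) : ℤ) : ℝ) / (2 ^ t * Q : ℕ) : ℝ) : ℂ)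
      simp only [cuspRepDil, if_neg htj', hY01]
      rw [hNeq, hRdef, hPdef, show t = (t - j) + j by omega, pow_add, Nat.add_sub_cancel]
      have hQc : (Q : ℂ) ≠ 0 := by exact_mod_cast hQ0.ne'
      have hmc : (m : ℂ) ≠ 0 := by exact_mod_cast hm0.ne'
      push_cast
      field_simp
      ring
    rw [hpt]
    have hRc : (R : ℂ) ≠ 0 := by exact_mod_cast (NeZero.ne R)
    have hPc : (P : ℂ) ≠ 0 := by exact_mod_cast (NeZero.ne P)
    push_cast
    field_simp

end TypesTwo

/-! ### 3. The trace coefficients at level `2ᵗM`, `t ≤ 5` -/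

section TraceFive

variable {t M : ℕ} [NeZero M] {W : WeierstrassCurve ℚ} [W.IsElliptic]

/-- `|aₙ(g)| = |aₙ(f)|` for all `n`, for the newforms `f`, `g` of `E`, `E^{(−1)}` at levels divisible
by `4` (both vanish at even `n`; `aₙ(g) = χ₄(n)aₙ(f)` at odd `n`). [folklore] -/
theorem _root_.Literature.NumberTheory.EllipticCurves.ModularForms.IsNewformOf.norm_cuspCoeff_quadraticTwist_neg_one
    {N N' : ℕ} [NeZero N] [NeZero N'] {f : CuspForm (Gamma0 N) 2} {g : CuspForm (Gamma0 N') 2}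
    (hf : IsNewformOf W f) (hg : IsNewformOf (W.quadraticTwist (-1)) g) (h4 : 4 ∣ N) (h4' : 4 ∣ N')
    (n : ℕ) : ‖cuspCoeff g n‖ = ‖cuspCoeff f n‖ := by
  by_cases hn : 2 ∣ n
  · rw [IsNewform0.cuspCoeff_eq_zero_of_two_dvd hf.1 h4 hn,
      IsNewform0.cuspCoeff_eq_zero_of_two_dvd hg.1 h4' hn]
  · rw [IsNewformOf.cuspCoeff_quadraticTwist_neg_one_of_odd hf hg hn, norm_mul]
    have h1 : ‖((ZMod.χ₄ n : ℤ) : ℂ)‖ = 1 := by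
      have hsq := χ₄_sq_eq_one_of_odd hn
      have : ((ZMod.χ₄ n : ℤ) : ℂ) ^ 2 = 1 := by exact_mod_cast hsq
      have hn2 : ‖((ZMod.χ₄ n : ℤ) : ℂ)‖ ^ 2 = 1 := by rw [← norm_pow, this, norm_one]
      exact (pow_eq_one_iff_of_nonneg (norm_nonneg _) two_ne_zero).mp hn2
    rw [h1, one_mul]

/-- **The slash of `f` by every representative when `t ≤ 5`**: a dilate of `f` (types with
`min(j, t−j) ≤ 1`) or of `g` (types with `min(j, t−j) = 2`), with `|K| = D/N`.
[cite: AtkinLehner1970, Thm. 3] -/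
theorem exists_slash_rep_five (hMo : Odd M) (hMs : Squarefree M) (ht : t ≤ 5) {m j k : ℕ} (hm : m ∣ M)
    (hj : j ≤ t) (hk : Odd k) {f g : CuspForm (Gamma0 (2 ^ t * M)) 2} (hf : IsNewformOf W f)
    (hg : IsNewformOf (W.quadraticTwist (-1)) g) :
    ∃ K : ℂ, ‖K‖ = (cuspRepDil t m j : ℝ) / (2 ^ t * M : ℕ) ∧ ∃ r : ℝ,
      (∀ τ : ℍ, ((⇑f : ℍ → ℂ) ∣[(2 : ℤ)] (mapGL ℝ (cuspRep t M m j k) : GL (Fin 2) ℝ)) τ =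
        K * f (UpperHalfPlane.mk (((cuspRepDil t m j : ℕ) : ℂ) / ((2 ^ t * M : ℕ) : ℕ) * τ + r)
          (im_dilate_pos (dil_pos j (pos_of_dvd hm)) r τ))) ∨
      (∀ τ : ℍ, ((⇑f : ℍ → ℂ) ∣[(2 : ℤ)] (mapGL ℝ (cuspRep t M m j k) : GL (Fin 2) ℝ)) τ =
        K * g (UpperHalfPlane.mk (((cuspRepDil t m j : ℕ) : ℂ) / ((2 ^ t * M : ℕ) : ℕ) * τ + r)
          (im_dilate_pos (dil_pos j (pos_of_dvd hm)) r τ))) := by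
  by_cases hsmall : min j (t - j) ≤ 1
  · obtain ⟨K, hK, r, h⟩ := exists_slash_rep hMo hMs hm hj hsmall hk hf.1
    exact ⟨K, hK, r, Or.inl h⟩
  · have hmin : min j (t - j) = 2 := by
      rcases le_total j (t - j) with h | h
      · rw [min_eq_left h] at hsmall ⊢; omega
      · rw [min_eq_right h] at hsmall ⊢; omega
    by_cases htj : t ≤ 2 * j
    · have hj2 : j + 2 = t := by
        rcases le_total j (t - j) with h | h
        · rw [min_eq_left h] at hmin; omega
        · rw [min_eq_right h] at hmin; omega
      obtain ⟨K, hK, r, h⟩ := exists_slash_rep_of_le_two hMo hMs hm hj2 htj hk hf hg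
      exact ⟨K, hK, r, Or.inr h⟩
    · have hj2 : j = 2 := by
        rcases le_total j (t - j) with h | h
        · rw [min_eq_left h] at hmin; omega
        · rw [min_eq_right h] at hmin; omega
      obtain ⟨K, hK, r, h⟩ := exists_slash_rep_of_lt_two hMo hMs hm (by omega) hj2 hk hf hg
      exact ⟨K, hK, r, Or.inr h⟩

/-- **The period-`N` coefficients on the cosets of type `(m, j, k)`, `t ≤ 5`**:
`|cₙ(f ∣ cuspRep T^l)|² = 𝟙[D ∣ n] (D/N)² |a_{n/D}(f)|²` (for the types sent to dilates of `g`,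
`|a(g)| = |a(f)|`). [cite: AtkinLehner1970, Thm. 3] -/
theorem norm_sq_coeff_slash_rep_mul_T_zpow_five (hMo : Odd M) (hMs : Squarefree M) (ht2 : 2 ≤ t)
    (ht : t ≤ 5) {m j k : ℕ} (hm : m ∣ M) (hj : j ≤ t) (hk : Odd k)
    {f g : CuspForm (Gamma0 (2 ^ t * M)) 2} (hf : IsNewformOf W f)
    (hg : IsNewformOf (W.quadraticTwist (-1)) g) (l : ℤ) (n : ℕ) :
    ‖(qExpansion ((2 ^ t * M : ℕ) : ℝ)
        ((⇑f : ℍ → ℂ) ∣[(2 : ℤ)] (cuspRep t M m j k * ModularGroup.T ^ l))).coeff n‖ ^ 2 =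
      if cuspRepDil t m j ∣ n then
        ((cuspRepDil t m j : ℝ) / (2 ^ t * M : ℕ)) ^ 2 * ‖cuspCoeff f (n / cuspRepDil t m j)‖ ^ 2 else 0 := by
  rw [norm_qExpansion_coeff_slash_mul_T_zpow f _ l n]
  have hF : IsCuspFunction ((2 ^ t * M : ℕ) : ℝ) ((⇑f : ℍ → ℂ) ∣[(2 : ℤ)] cuspRep t M m j k) :=
    isCuspFunction_slash f _
  obtain ⟨K, hK, r, hFg | hFg⟩ := exists_slash_rep_five hMo hMs ht hm hj hk hf hg
  · have hFg' : ∀ τ : ℍ, ((⇑f : ℍ → ℂ) ∣[(2 : ℤ)] cuspRep t M m j k) τ =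
        K * f (UpperHalfPlane.mk (((cuspRepDil t m j : ℕ) : ℂ) / ((2 ^ t * M : ℕ) : ℕ) * τ + r)
          (im_dilate_pos (dil_pos j (pos_of_dvd hm)) r τ)) := fun τ ↦ by
      rw [ModularForm.SL_slash]; exact hFg τ
    have h := norm_sq_qExpansion_coeff_of_eq_dilate f hF K (dil_pos j (pos_of_dvd hm)) (dil_dvd j hm) r
      hFg' n
    rw [hK] at h
    exact_mod_cast h
  · have hFg' : ∀ τ : ℍ, ((⇑f : ℍ → ℂ) ∣[(2 : ℤ)] cuspRep t M m j k) τ =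
        K * g (UpperHalfPlane.mk (((cuspRepDil t m j : ℕ) : ℂ) / ((2 ^ t * M : ℕ) : ℕ) * τ + r)
          (im_dilate_pos (dil_pos j (pos_of_dvd hm)) r τ)) := fun τ ↦ by
      rw [ModularForm.SL_slash]; exact hFg τ
    have h := norm_sq_qExpansion_coeff_of_eq_dilate g hF K (dil_pos j (pos_of_dvd hm)) (dil_dvd j hm) r
      hFg' n
    have h4 : 4 ∣ 2 ^ t * M := four_dvd_of_two_le ht2
    rw [hK, hf.norm_cuspCoeff_quadraticTwist_neg_one hg h4 h4] at h
    exact_mod_cast h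

/-- **The coefficients of the Rankin–Selberg trace of the newform of `E` at level `2ᵗM`**, `M` odd
squarefree, `2 ≤ t ≤ 5` (given the newform `g` of `E^{(−1)}` at the same level, which enters the
expansions at the cusps of type `min(j, t−j) = 2`): the same dilate-sum as for `t ≤ 3`.
[cite: Rankin1939, §4; AtkinLehner1970, Thm. 3] -/
theorem _root_.Literature.NumberTheory.EllipticCurves.ModularForms.IsNewformOf.rsCoeff_eq_of_two_pow_mul_five
    (hMo : Odd M) (hMs : Squarefree M) (ht2 : 2 ≤ t) (ht : t ≤ 5)
    {f g : CuspForm (Gamma0 (2 ^ t * M)) 2} (hf : IsNewformOf W f)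
    (hg : IsNewformOf (W.quadraticTwist (-1)) g) (n : ℕ) :
    rsCoeff (2 ^ t * M) 2 f n = ∑ m ∈ M.divisors, ∑ j ∈ Finset.range (t + 1),
      (((kSet (min j (t - j))).card * cuspRepWidth t M m j : ℕ) : ℝ) *
        (if cuspRepDil t m j ∣ n then
          ((cuspRepDil t m j : ℝ) / (2 ^ t * M : ℕ)) ^ 2 * ‖cuspCoeff f (n / cuspRepDil t m j)‖ ^ 2 else 0) := by
  classical
  haveI : Fintype (SL(2, ℤ) ⧸ Gamma0 (2 ^ t * M)) := Fintype.ofFinite _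
  rw [rsCoeff_eq_sum, sum_quotient_eq_sum_types hMo hMs]
  refine Finset.sum_congr rfl fun m hm ↦ Finset.sum_congr rfl fun j hj ↦ ?_
  have hmM : m ∣ M := Nat.dvd_of_mem_divisors hm
  have hjt : j ≤ t := by have := Finset.mem_range.mp hj; omega
  have hval : ∀ k ∈ kSet (min j (t - j)), ∀ l ∈ Finset.range (cuspRepWidth t M m j),
      ‖(qExpansion ((2 ^ t * M : ℕ) : ℝ) ((⇑f : ℍ → ℂ) ∣[(2 : ℤ)]
        (Quotient.out (QuotientGroup.mk ((cuspRep t M m j k * ModularGroup.T ^ (l : ℤ))⁻¹) :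
          SL(2, ℤ) ⧸ Gamma0 (2 ^ t * M)))⁻¹)).coeff n‖ ^ 2 =
      if cuspRepDil t m j ∣ n then
        ((cuspRepDil t m j : ℝ) / (2 ^ t * M : ℕ)) ^ 2 * ‖cuspCoeff f (n / cuspRepDil t m j)‖ ^ 2 else 0 := by
    intro k hk l _
    obtain ⟨γ, hγ⟩ := QuotientGroup.mk_out_eq_mul (Gamma0 (2 ^ t * M))
      ((cuspRep t M m j k * ModularGroup.T ^ (l : ℤ))⁻¹)
    rw [hγ, mul_inv_rev, inv_inv, SlashAction.slash_mul, slash_eq_self_of_mem_Gamma0 f (inv_mem γ.2)]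
    exact norm_sq_coeff_slash_rep_mul_T_zpow_five hMo hMs ht2 ht hmM hjt (odd_of_mem_kSet hk) hf hg _ n
  rw [Finset.sum_congr rfl fun k hk ↦ Finset.sum_congr rfl fun l hl ↦ hval k hk l hl]
  simp only [Finset.sum_const, Finset.card_range, nsmul_eq_mul]
  push_cast
  ring

/-- The same in the dilate-sum shape of `LSeries_rsCoeff_eq_of_sum_dilate`. [cite: Rankin1939, §4] -/
theorem _root_.Literature.NumberTheory.EllipticCurves.ModularForms.IsNewformOf.rsCoeff_eq_sum_tpS_five
    (hMo : Odd M) (hMs : Squarefree M) (ht2 : 2 ≤ t) (ht : t ≤ 5)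
    {f g : CuspForm (Gamma0 (2 ^ t * M)) 2} (hf : IsNewformOf W f)
    (hg : IsNewformOf (W.quadraticTwist (-1)) g) (n : ℕ) :
    rsCoeff (2 ^ t * M) 2 f n =
      ∑ x ∈ tpS t M, if dilP t x ∣ n then tpC t M x * ‖cuspCoeff f (n / dilP t x)‖ ^ 2 else 0 := by
  rw [hf.rsCoeff_eq_of_two_pow_mul_five hMo hMs ht2 ht hg n, tpS, Finset.sum_product]
  refine Finset.sum_congr rfl fun m _ ↦ Finset.sum_congr rfl fun j _ ↦ ?_
  simp only [tpC, dilP]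
  split_ifs
  · ring
  · rw [mul_zero]

omit [NeZero M] in
/-- For `t ≤ 5`, `#kSet(min(j, t−j)) ≤ 2`. [folklore] -/
theorem card_kSet_le_two (ht : t ≤ 5) {j : ℕ} (hj : j ≤ t) : (kSet (min j (t - j))).card ≤ 2 := by
  rw [card_kSet]
  have : min j (t - j) ≤ 2 := by
    rcases le_total j (t - j) with h | h
    · rw [min_eq_left h]; omega
    · rw [min_eq_right h]; omega
  interval_cases (min j (t - j)) <;> decide

omit [NeZero M] in
/-- **`|A_t(s)| ≤ 12`** for `t ≤ 5` and `Re s ≥ 0` (at most `6` terms of modulus `≤ #kSet ≤ 2`). [folklore] -/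
theorem norm_twoFactor_le_twelve (ht : t ≤ 5) {s : ℂ} (hs : 0 ≤ s.re) : ‖twoFactor t s‖ ≤ 12 := by
  have hP : ∀ P : ℕ, 0 < P → ‖((P : ℕ) : ℂ) ^ (-s)‖ ≤ 1 := by
    intro P hP
    rw [Complex.norm_natCast_cpow_of_pos hP, Complex.neg_re]
    exact Real.rpow_le_one_of_one_le_of_nonpos (by exact_mod_cast hP) (by linarith)
  have hterm : ∀ j ∈ Finset.range (t + 1), ‖((kSet (min j (t - j))).card : ℂ) *
      (if t ≤ 2 * j then ((2 ^ t : ℕ) : ℂ) ^ (-s) else ((2 ^ (2 * j) : ℕ) : ℂ) ^ (-s))‖ ≤ 2 := by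
    intro j hj
    have hjt : j ≤ t := by have := Finset.mem_range.mp hj; omega
    rw [norm_mul, Complex.norm_natCast]
    have h1 : ‖(if t ≤ 2 * j then ((2 ^ t : ℕ) : ℂ) ^ (-s) else ((2 ^ (2 * j) : ℕ) : ℂ) ^ (-s))‖ ≤ 1 := by
      split_ifs
      · exact hP _ (by positivity)
      · exact hP _ (by positivity)
    have h2 : ((kSet (min j (t - j))).card : ℝ) ≤ 2 := by exact_mod_cast card_kSet_le_two ht hjt
    calc ((kSet (min j (t - j))).card : ℝ) *
          ‖(if t ≤ 2 * j then ((2 ^ t : ℕ) : ℂ) ^ (-s) else ((2 ^ (2 * j) : ℕ) : ℂ) ^ (-s))‖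
        ≤ 2 * 1 := mul_le_mul h2 h1 (norm_nonneg _) (by norm_num)
      _ = 2 := by norm_num
  calc ‖twoFactor t s‖ ≤ ∑ j ∈ Finset.range (t + 1), ‖((kSet (min j (t - j))).card : ℂ) *
        (if t ≤ 2 * j then ((2 ^ t : ℕ) : ℂ) ^ (-s) else ((2 ^ (2 * j) : ℕ) : ℂ) ^ (-s))‖ :=
        norm_sum_le _ _
    _ ≤ ∑ j ∈ Finset.range (t + 1), (2 : ℝ) := Finset.sum_le_sum hterm
    _ = 2 * (t + 1) := by simp; ring
    _ ≤ 12 := by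
        have h5 : (t : ℝ) ≤ 5 := by exact_mod_cast ht
        linarith

end TraceFive

/-! ### 4. Mai–Murty's bound at the levels `2ᵗM`, `2 ≤ t ≤ 5` -/

section MainFive

open _root_.MeasureTheory _root_.Set _root_.Filter _root_.Real

variable {t M : ℕ} [NeZero M] {W : WeierstrassCurve ℚ} [W.IsElliptic]

set_option maxHeartbeats 1000000 in
/-- **The Petersson norm of the newform of an elliptic curve of conductor `2ᵗM`, `M` odd squarefree,
`2 ≤ t ≤ 5`, is `≪ N (log N)³`** (Mai–Murty's printed exponent `3`), given the newform `g` of the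
twist `E^{(−1)}` at the same level (true for the Frey–Hellegouarch curves with `2⁵ ∥ N`, whose twist by
`−1` is again of that shape): an absolute `C > 0` with `Re (f, f)_{Γ₀(N)} ≤ C · N · (1 + log N)³`.
The proof of `exists_petersson_le_mul_log_cube_of_two_pow_mul` verbatim, on the dictionary
`IsNewformOf.rsCoeff_eq_sum_tpS_five` (the cusps of type `min(j, t−j) = 2` see dilates of `g`, whose
coefficients have the same moduli as those of `f`) and `|A_t(s)| ≤ 12`; `C = 2·3⁵·(7/3)⁵·384·e·4³`.
[cite: MaiMurty1994, §2 (L(1, Sym² f) = O((log N)³); Proposition: log⟨f,f⟩ = O(log N))] -/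
theorem exists_petersson_le_mul_log_cube_of_two_pow_mul_five :
    ∃ C : ℝ, 0 < C ∧ ∀ (t M : ℕ) [NeZero M], 2 ≤ t → t ≤ 5 → Odd M → Squarefree M →
      ∀ (W : WeierstrassCurve ℚ) [W.IsElliptic] (f g : CuspForm (Gamma0 (2 ^ t * M)) 2), IsNewformOf W f →
        IsNewformOf (W.quadraticTwist (-1)) g →
        (peterssonProduct (Gamma0 (2 ^ t * M)) 2 f f).re ≤
          C * (2 ^ t * M : ℕ) * (1 + Real.log (2 ^ t * M : ℕ)) ^ 3 := by
  obtain ⟨Q, hQ, hQbd⟩ := exists_norm_J₀_le_uniform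
  refine ⟨2 * 3 ^ 5 * (7 / 3) ^ 5 * 384 * Real.exp 1 * 4 ^ 3, by positivity, ?_⟩
  intro t M _ ht2 ht5 hMo hMs W _ f g hf hg
  have hπ := Real.pi_pos
  have hN0 : (0 : ℝ) < ((2 ^ t * M : ℕ) : ℝ) := Nat.cast_pos.mpr (NeZero.pos (2 ^ t * M))
  have hN1 : (1 : ℝ) ≤ ((2 ^ t * M : ℕ) : ℝ) := by exact_mod_cast NeZero.one_le
  have hlogN : 0 ≤ Real.log ((2 ^ t * M : ℕ) : ℝ) := Real.log_nonneg hN1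
  -- the horocycle datum of the trace `G_f` (as in `NewformPeterssonSizeSiegelProofs`)
  have hGc : Continuous (rsTrace (2 ^ t * M) 2 f) := continuous_rsTrace (ModularFormClass.continuous f)
  have hGinv : ∀ (A : SL(2, ℤ)) (τ : UpperHalfPlane), rsTrace (2 ^ t * M) 2 f (A • τ) = rsTrace (2 ^ t * M) 2 f τ :=
    fun A τ ↦ rsTrace_smul f A τ
  have hG0 : ∀ τ, 0 ≤ rsTrace (2 ^ t * M) 2 f τ := fun τ ↦ rsTrace_nonneg _ τ
  obtain ⟨B, -, hB⟩ := exists_rsTrace_le f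
  have hC : ∀ n, 0 ≤ rsCoeff (2 ^ t * M) 2 f n := fun n ↦ rsCoeff_nonneg _ n
  have hC0 : rsCoeff (2 ^ t * M) 2 f 0 = 0 := rsCoeff_zero f
  set a : ℝ := 4 * π / ((2 ^ t * M : ℕ) : ℝ) with hadef
  have ha : 0 < a := by positivity
  have hs : ∀ y : ℝ, 0 < y → Summable fun n : ℕ ↦ rsCoeff (2 ^ t * M) 2 f n * Real.exp (-a * n * y) :=
    fun y hy ↦ summable_rsCoeff_mul_exp_datum f hy
  have hm : ∀ y : ℝ, 0 < y → ∫ x in (0 : ℝ)..1, rsTrace (2 ^ t * M) 2 f (pt x y) =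
      y ^ (2 : ℝ) * ∑' n : ℕ, rsCoeff (2 ^ t * M) 2 f n * Real.exp (-a * n * y) :=
    fun y hy ↦ horocycle_rsTrace_datum f hy
  have hκ : (0 : ℝ) ≤ 2 := by norm_num
  -- `J`, `V`, `Z`
  set J : ℂ → ℂ := fun s ↦ ∫ w in ModularGroup.fd, (rsTrace (2 ^ t * M) 2 f w : ℂ) * completedEisenstein₀ w s
    with hJdef
  set V : ℝ := ∫ w in ModularGroup.fd, rsTrace (2 ^ t * M) 2 f w with hVdef
  have hVeq : (peterssonProduct (Gamma0 (2 ^ t * M)) 2 f f).re = V :=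
    peterssonProduct_self_re_eq_integral_rsTrace f
  have hV0 : 0 ≤ V := setIntegral_nonneg ModularGroup.isClosed_fd.measurableSet fun w _ ↦ hG0 w
  have hJ : Differentiable ℂ J := differentiable_J₀ hGc hGinv hG0 hB hC hC0 ha hκ hs hm
  have hJbd : ∀ s : ℂ, -1 / 2 ≤ s.re → s.re ≤ 7 / 2 → ‖J s‖ ≤ Q * (1 + a⁻¹) ^ 4 * V :=
    fun s h1 h2 ↦ hQbd hGc hGinv hG0 hB hC hC0 ha hs hm h1 h2
  set Mb : ℝ := Q * (1 + a⁻¹) ^ 4 * V with hMbdef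
  have hMb0 : 0 ≤ Mb := by positivity
  set Z : ℂ → ℂ := fun s ↦ s * (s - 1) * J s + (V : ℂ) / 2 with hZdef
  have hZdiff : Differentiable ℂ Z :=
    ((differentiable_id.mul (differentiable_id.sub_const 1)).mul hJ).add_const _
  have hZsymm : ∀ s : ℂ, Z (1 - s) = Z s := by
    intro s
    have hJs : J (1 - s) = J s := J₀_one_sub (fun w ↦ rsTrace (2 ^ t * M) 2 f w) s
    show (1 - s) * (1 - s - 1) * J (1 - s) + (V : ℂ) / 2 = s * (s - 1) * J s + (V : ℂ) / 2
    rw [hJs]; ring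
  have hZone : Z 1 = (V : ℂ) / 2 := by
    show (1 : ℂ) * (1 - 1) * J 1 + (V : ℂ) / 2 = (V : ℂ) / 2
    ring
  -- finite order in the strip `-1/2 ≤ Re s ≤ 3/2`
  have hgrowth : ∀ z : ℂ, -1 / 2 ≤ z.re → z.re ≤ 3 / 2 →
      ‖Z z‖ ≤ (4 * Mb + V / 2) * Real.exp (|z.im| ^ (1 : ℝ)) := by
    intro z hz1 hz2
    rw [Real.rpow_one]
    have hz : ‖z‖ ≤ 2 + |z.im| := by
      have := Complex.norm_le_abs_re_add_abs_im z
      have : |z.re| ≤ 2 := abs_le.2 ⟨by linarith, by linarith⟩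
      linarith
    have hz' : ‖z - 1‖ ≤ 2 + |z.im| := by
      have := Complex.norm_le_abs_re_add_abs_im (z - 1)
      rw [Complex.sub_re, Complex.sub_im, Complex.one_re, Complex.one_im, sub_zero] at this
      have : |z.re - 1| ≤ 2 := abs_le.2 ⟨by linarith, by linarith⟩
      linarith
    have hexp := two_add_sq_le_four_mul_exp (abs_nonneg z.im)
    have h1e : 1 ≤ Real.exp |z.im| := Real.one_le_exp (abs_nonneg _)
    have hVn : ‖(V : ℂ) / 2‖ = V / 2 := by
      rw [norm_div, Complex.norm_real, Complex.norm_ofNat, Real.norm_of_nonneg hV0]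
    calc ‖Z z‖ = ‖z * (z - 1) * J z + (V : ℂ) / 2‖ := rfl
      _ ≤ ‖z * (z - 1) * J z‖ + ‖(V : ℂ) / 2‖ := norm_add_le _ _
      _ = ‖z‖ * ‖z - 1‖ * ‖J z‖ + V / 2 := by rw [norm_mul, norm_mul, hVn]
      _ ≤ (2 + |z.im|) * (2 + |z.im|) * Mb + V / 2 * 1 := by
          rw [mul_one]
          have hJz : ‖J z‖ ≤ Mb := hJbd z hz1 (by linarith)
          have h1 : ‖z‖ * ‖z - 1‖ ≤ (2 + |z.im|) * (2 + |z.im|) :=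
            mul_le_mul hz hz' (norm_nonneg _) (by positivity)
          have h2 : ‖z‖ * ‖z - 1‖ * ‖J z‖ ≤ (2 + |z.im|) * (2 + |z.im|) * Mb :=
            mul_le_mul h1 hJz (norm_nonneg _) (by positivity)
          linarith
      _ ≤ (4 * Real.exp |z.im|) * Mb + V / 2 * Real.exp |z.im| := by
          have h3 : (2 + |z.im|) * (2 + |z.im|) ≤ 4 * Real.exp |z.im| := by rw [← sq]; exact hexp
          have h4 : (2 + |z.im|) * (2 + |z.im|) * Mb ≤ 4 * Real.exp |z.im| * Mb :=
            mul_le_mul_of_nonneg_right h3 hMb0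
          have h5 : V / 2 * 1 ≤ V / 2 * Real.exp |z.im| := mul_le_mul_of_nonneg_left h1e (by linarith)
          linarith
      _ = (4 * Mb + V / 2) * Real.exp |z.im| := by ring
  -- the parameter `δ` and the real zeta value `ζ(1 + δ)`
  set δ : ℝ := 1 / (2 + Real.log ((2 ^ t * M : ℕ) : ℝ)) with hδdef
  have hδ0 : 0 < δ := by positivity
  have hδhalf : δ ≤ 1 / 2 := by
    rw [hδdef]; exact one_div_le_one_div_of_le (by norm_num) (by linarith)
  set ζδ : ℝ := ∑' n : ℕ, 1 / (n : ℝ) ^ (1 + δ) with hζδdef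
  have hζδpos : 0 < ζδ := tsum_one_div_nat_rpow_pos (by linarith)
  have hζδle : ζδ ≤ 4 + Real.log ((2 ^ t * M : ℕ) : ℝ) := by
    have h := tsum_one_div_nat_rpow_le (σ := 1 + δ) (by linarith)
    have hδne : δ ≠ 0 := hδ0.ne'
    have e1 : (1 + δ) / (1 + δ - 1) + 1 = 2 + 1 / δ := by
      rw [show (1 : ℝ) + δ - 1 = δ by ring]; field_simp; ring
    have e2 : 1 / δ = 2 + Real.log ((2 ^ t * M : ℕ) : ℝ) := by rw [hδdef, one_div_one_div]
    linarith
  have hNδ : ((2 ^ t * M : ℕ) : ℝ) ^ δ ≤ Real.exp 1 := by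
    rw [Real.rpow_def_of_pos hN0]
    refine Real.exp_le_exp.2 ?_
    rw [hδdef, mul_one_div]
    exact div_le_one_of_le₀ (by linarith) (by linarith)
  -- the bound on the line `Re s = 1 + δ`
  set A₀ : ℝ := 384 * (((2 ^ t * M : ℕ) : ℝ) * ((2 ^ t * M : ℕ) : ℝ) ^ δ) * ζδ ^ 3 with hA₀def
  have hA₀pos : 0 < A₀ := by positivity
  have hright : ∀ z : ℂ, z.re = 1 + δ → ‖Z z‖ ≤ A₀ * ‖z + 2‖ ^ 5 := by
    intro z hz
    have hz1 : 1 < z.re := by rw [hz]; linarith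
    have hzne : z ≠ 1 := fun h ↦ by rw [h, Complex.one_re] at hz1; exact lt_irrefl _ hz1
    have hZeq : Z z = z * (z - 1) * ((π : ℂ) ^ (-z) * Complex.Gamma z * riemannZeta (2 * z) *
          (Complex.Gamma (z + 1) * (((4 * π / ((2 ^ t * M : ℕ) : ℝ) : ℝ)) : ℂ) ^ (-(z + 1)))) *
        ((((2 ^ t * M : ℕ) : ℂ)⁻¹ * twoFactor t z * ∑ c ∈ M.divisors, (c : ℂ) ^ (-z)) *
          LSeries (fun n ↦ (((‖cuspCoeff f n‖ ^ 2 : ℝ)) : ℂ)) (z + 1)) := by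
      have h := traceZeta_eq_of_sum_dilate (tpS t M) (tpC t M) (dilP t) (fun i hi ↦ dilP_pos hi) f
        (hf.rsCoeff_eq_sum_tpS_five hMo hMs ht2 ht5 hg) hz1
      rw [sum_tpC_mul_cpow_eq hMo hMs z] at h
      exact h
    have hZeq' : Z z = z * ((π : ℂ) ^ (-z) * Complex.Gamma z * riemannZeta (2 * z) *
          (Complex.Gamma (z + 1) * (((4 * π / ((2 ^ t * M : ℕ) : ℝ) : ℝ)) : ℂ) ^ (-(z + 1)))) * ((2 ^ t * M : ℕ) : ℂ)⁻¹ *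
        ((z - 1) * (twoFactor t z * ((∑ c ∈ M.divisors, (c : ℂ) ^ (-z)) *
          LSeries (fun n ↦ (((‖cuspCoeff f n‖ ^ 2 : ℝ)) : ℂ)) (z + 1)))) := by
      rw [hZeq]; ring
    -- the factors
    have b1 : ‖z‖ ≤ ‖z + 2‖ := norm_le_norm_add_two (by linarith)
    have b3 : ‖(π : ℂ) ^ (-z)‖ ≤ 1 :=
      norm_ofReal_cpow_neg_le_one (by linarith [Real.pi_gt_three]) (by linarith)
    have b4 : ‖Complex.Gamma z‖ ≤ 1 := norm_Gamma_le_one (by linarith) (by linarith)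
    have b5 : ‖riemannZeta (2 * z)‖ ≤ 2 * ‖z + 2‖ := by
      have h := norm_riemannZeta_two_mul_le (s := z) (by linarith)
      have h3 : (3 : ℝ) ≤ ‖z + 2‖ := by
        have := Complex.re_le_norm (z + 2)
        rw [Complex.add_re, Complex.re_ofNat] at this
        linarith
      linarith
    have b6 : ‖Complex.Gamma (z + 1)‖ ≤ ‖z + 2‖ := by
      have hz0 : z ≠ 0 := fun h ↦ by rw [h, Complex.zero_re] at hz1; linarith
      rw [Complex.Gamma_add_one z hz0, norm_mul]
      calc ‖z‖ * ‖Complex.Gamma z‖ ≤ ‖z + 2‖ * 1 := by gcongr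
        _ = ‖z + 2‖ := mul_one _
    have b7 : ‖(((4 * π / ((2 ^ t * M : ℕ) : ℝ) : ℝ)) : ℂ) ^ (-(z + 1))‖ ≤ ((2 ^ t * M : ℕ) : ℝ) * (((2 ^ t * M : ℕ) : ℝ) * ((2 ^ t * M : ℕ) : ℝ) ^ δ) := by
      have h := norm_cpow_level_le (NeZero.pos (2 ^ t * M)) (s := z) (by linarith)
      rw [hz, Real.rpow_add hN0, Real.rpow_one] at h
      exact h
    have b8 : ‖((2 ^ t * M : ℕ) : ℂ)⁻¹‖ = ((2 ^ t * M : ℕ) : ℝ)⁻¹ := by rw [norm_inv, Complex.norm_natCast]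
    -- the key bound and the pole factor
    have b9 : ‖twoFactor t z * ((∑ c ∈ M.divisors, (c : ℂ) ^ (-z)) *
        LSeries (fun n ↦ (((‖cuspCoeff f n‖ ^ 2 : ℝ)) : ℂ)) (z + 1))‖ ≤ 96 * ζδ ^ 3 * ‖riemannZeta z‖ := by
      rw [norm_mul]
      have h1 : ‖twoFactor t z‖ ≤ 12 := norm_twoFactor_le_twelve ht5 (by linarith)
      have h2 := hf.norm_sum_divisors_mul_LSeries_le_eight_mul hMo hMs ht2 hδ0 hz
      calc ‖twoFactor t z‖ * ‖(∑ c ∈ M.divisors, (c : ℂ) ^ (-z)) *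
            LSeries (fun n ↦ (((‖cuspCoeff f n‖ ^ 2 : ℝ)) : ℂ)) (z + 1)‖
          ≤ 12 * (8 * ζδ ^ 3 * ‖riemannZeta z‖) :=
            mul_le_mul h1 h2 (norm_nonneg _) (by norm_num)
        _ = 96 * ζδ ^ 3 * ‖riemannZeta z‖ := by ring
    have b10 : ‖z - 1‖ * ‖riemannZeta z‖ ≤ 2 * ‖z + 2‖ ^ 2 :=
      norm_sub_one_mul_norm_riemannZeta_le (by linarith) hzne
    have b11 : ‖(z - 1) * (twoFactor t z * ((∑ c ∈ M.divisors, (c : ℂ) ^ (-z)) *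
        LSeries (fun n ↦ (((‖cuspCoeff f n‖ ^ 2 : ℝ)) : ℂ)) (z + 1)))‖ ≤ 192 * ζδ ^ 3 * ‖z + 2‖ ^ 2 := by
      rw [norm_mul]
      calc ‖z - 1‖ * ‖twoFactor t z * ((∑ c ∈ M.divisors, (c : ℂ) ^ (-z)) *
            LSeries (fun n ↦ (((‖cuspCoeff f n‖ ^ 2 : ℝ)) : ℂ)) (z + 1))‖
          ≤ ‖z - 1‖ * (96 * ζδ ^ 3 * ‖riemannZeta z‖) := mul_le_mul_of_nonneg_left b9 (norm_nonneg _)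
        _ = 96 * ζδ ^ 3 * (‖z - 1‖ * ‖riemannZeta z‖) := by ring
        _ ≤ 96 * ζδ ^ 3 * (2 * ‖z + 2‖ ^ 2) := by gcongr
        _ = 192 * ζδ ^ 3 * ‖z + 2‖ ^ 2 := by ring
    calc ‖Z z‖ = ‖z‖ * (‖(π : ℂ) ^ (-z)‖ * ‖Complex.Gamma z‖ * ‖riemannZeta (2 * z)‖ *
          (‖Complex.Gamma (z + 1)‖ * ‖(((4 * π / ((2 ^ t * M : ℕ) : ℝ) : ℝ)) : ℂ) ^ (-(z + 1))‖)) * ‖((2 ^ t * M : ℕ) : ℂ)⁻¹‖ *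
        ‖(z - 1) * (twoFactor t z * ((∑ c ∈ M.divisors, (c : ℂ) ^ (-z)) *
          LSeries (fun n ↦ (((‖cuspCoeff f n‖ ^ 2 : ℝ)) : ℂ)) (z + 1)))‖ := by
          rw [hZeq']; simp only [norm_mul]
      _ ≤ ‖z + 2‖ * (1 * 1 * (2 * ‖z + 2‖) * (‖z + 2‖ * (((2 ^ t * M : ℕ) : ℝ) * (((2 ^ t * M : ℕ) : ℝ) * ((2 ^ t * M : ℕ) : ℝ) ^ δ)))) * ((2 ^ t * M : ℕ) : ℝ)⁻¹ *
        (192 * ζδ ^ 3 * ‖z + 2‖ ^ 2) := by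
          rw [b8]
          gcongr
      _ = A₀ * ‖z + 2‖ ^ 5 := by
          rw [hA₀def]
          field_simp
          ring
  -- the bound on both lines, with `A = (7/3)⁵ A₀`
  set A : ℝ := (7 / 3) ^ 5 * A₀ with hAdef
  have hApos : 0 < A := by positivity
  have hA₀A : A₀ ≤ A := by
    rw [hAdef]
    have : (1 : ℝ) ≤ (7 / 3) ^ 5 := by norm_num
    nlinarith
  have hb : ∀ z : ℂ, z.re = 1 + δ → ‖Z z‖ ≤ A * ‖(2 : ℂ) + z‖ ^ (5 : ℝ) := by
    intro z hz
    rw [show (5 : ℝ) = (5 : ℕ) by norm_num, Real.rpow_natCast, add_comm (2 : ℂ) z]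
    exact (hright z hz).trans (mul_le_mul_of_nonneg_right hA₀A (by positivity))
  have ha' : ∀ z : ℂ, z.re = -δ → ‖Z z‖ ≤ A * ‖(2 : ℂ) + z‖ ^ (5 : ℝ) := by
    intro z hz
    rw [show (5 : ℝ) = (5 : ℕ) by norm_num, Real.rpow_natCast, add_comm (2 : ℂ) z]
    have hsym : Z z = Z (1 - z) := by
      have := hZsymm (1 - z); rwa [sub_sub_cancel] at this
    have h1z : (1 - z).re = 1 + δ := by simp [hz]
    have h := hright (1 - z) h1z
    have h3 : ‖1 - z + 2‖ ≤ 7 / 3 * ‖z + 2‖ := by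
      rw [show (1 : ℂ) - z + 2 = 3 - z by ring]
      exact norm_three_sub_le (by rw [hz]; linarith)
    rw [hsym]
    calc ‖Z (1 - z)‖ ≤ A₀ * ‖1 - z + 2‖ ^ 5 := h
      _ ≤ A₀ * (7 / 3 * ‖z + 2‖) ^ 5 := by gcongr
      _ = A * ‖z + 2‖ ^ 5 := by rw [hAdef]; ring
  -- Phragmén–Lindelöf at `s = 1`
  have hgr : ∀ z : ℂ, -δ < z.re → z.re < 1 + δ →
      ‖Z z‖ ≤ (4 * Mb + V / 2) * Real.exp (|z.im| ^ (1 : ℝ)) :=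
    fun z h1 h2 ↦ hgrowth z (by linarith) (by linarith)
  have hPL := Literature.Analysis.Complex.rademacher_phragmenLindelof_of_finiteOrder (f := Z) (a := -δ) (b := 1 + δ)
    (Q := 2) (A := A) (B := A) (α := 5) (β := 5) (C := 4 * Mb + V / 2) (c := 1)
    (by linarith) (by linarith) hApos hApos le_rfl hZdiff.diffContOnCl one_pos hgr ha' hb
    (z := 1) (by simp; linarith) (by simp; linarith)
  -- `‖Z 1‖ ≤ 243 A`
  have h243 : ‖((2 : ℝ) : ℂ) + 1‖ ^ (5 : ℝ) = 243 := by
    rw [show ((2 : ℝ) : ℂ) + 1 = (3 : ℝ) by push_cast; norm_num, Complex.norm_real,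
      Real.norm_of_nonneg (by norm_num : (0 : ℝ) ≤ 3), show (5 : ℝ) = (5 : ℕ) by norm_num,
      Real.rpow_natCast]
    norm_num
  have hx : 0 < A * 243 := by positivity
  have hZ1 : ‖Z 1‖ ≤ A * 243 := by
    rw [h243, Complex.one_re] at hPL
    have e : (1 + δ - 1) / (1 + δ - -δ) + (1 - -δ) / (1 + δ - -δ) = 1 := by
      rw [← add_div, show (1 : ℝ) + δ - 1 + (1 - -δ) = 1 + δ - -δ by ring,
        div_self (by linarith : (1 : ℝ) + δ - -δ ≠ 0)]
    calc ‖Z 1‖ ≤ (A * 243) ^ ((1 + δ - 1) / (1 + δ - -δ)) * (A * 243) ^ ((1 - -δ) / (1 + δ - -δ)) := hPL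
      _ = A * 243 := by rw [← Real.rpow_add hx, e, Real.rpow_one]
  -- conclusion
  have hV : V / 2 ≤ A * 243 := by
    have : ‖Z 1‖ = V / 2 := by
      rw [hZone, norm_div, Complex.norm_real, Complex.norm_ofNat, Real.norm_of_nonneg hV0]
    rw [← this]; exact hZ1
  rw [hVeq]
  have hζ3 : ζδ ^ 3 ≤ (4 * (1 + Real.log ((2 ^ t * M : ℕ) : ℝ))) ^ 3 :=
    pow_le_pow_left₀ hζδpos.le (by linarith) 3
  calc V ≤ 2 * (A * 243) := by linarith
    _ = 2 * 3 ^ 5 * (7 / 3) ^ 5 * 384 * (((2 ^ t * M : ℕ) : ℝ) * ((2 ^ t * M : ℕ) : ℝ) ^ δ * ζδ ^ 3) := by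
        rw [hAdef, hA₀def]; ring
    _ ≤ 2 * 3 ^ 5 * (7 / 3) ^ 5 * 384 * (((2 ^ t * M : ℕ) : ℝ) * Real.exp 1 * (4 * (1 + Real.log ((2 ^ t * M : ℕ) : ℝ))) ^ 3) := by gcongr
    _ = 2 * 3 ^ 5 * (7 / 3) ^ 5 * 384 * Real.exp 1 * 4 ^ 3 * ((2 ^ t * M : ℕ) : ℝ) * (1 + Real.log ((2 ^ t * M : ℕ) : ℝ)) ^ 3 := by ring



/-- **Power form `(f, f) ≪ N^{1+ε}/ε³`** of `exists_petersson_le_mul_log_cube_of_two_pow_mul_five`.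
[cite: MaiMurty1994, §2, Proposition] -/
theorem exists_petersson_le_mul_rpow_of_two_pow_mul_five :
    ∃ C : ℝ, 0 < C ∧ ∀ ε : ℝ, 0 < ε → ε ≤ 1 → ∀ (t M : ℕ) [NeZero M], 2 ≤ t → t ≤ 5 → Odd M → Squarefree M →
      ∀ (W : WeierstrassCurve ℚ) [W.IsElliptic] (f g : CuspForm (Gamma0 (2 ^ t * M)) 2), IsNewformOf W f →
        IsNewformOf (W.quadraticTwist (-1)) g →
        (peterssonProduct (Gamma0 (2 ^ t * M)) 2 f f).re ≤ C * ((2 ^ t * M : ℕ) : ℝ) ^ (1 + ε) / ε ^ 3 := by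
  obtain ⟨C, hC, h⟩ := exists_petersson_le_mul_log_cube_of_two_pow_mul_five
  refine ⟨C * 4 ^ 3, by positivity, fun ε hε hε1 t M _ ht2 ht5 hMo hMs W _ f g hf hg ↦ ?_⟩
  have hN1 : (1 : ℝ) ≤ ((2 ^ t * M : ℕ) : ℝ) := by exact_mod_cast NeZero.one_le (n := 2 ^ t * M)
  calc (peterssonProduct (Gamma0 (2 ^ t * M)) 2 f f).re
      ≤ C * (2 ^ t * M : ℕ) * (1 + Real.log (2 ^ t * M : ℕ)) ^ 3 := h t M ht2 ht5 hMo hMs W f g hf hg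
    _ = C * ((2 ^ t * M : ℕ) * (1 + Real.log (2 ^ t * M : ℕ)) ^ 3) := by ring
    _ ≤ C * (4 ^ 3 * ((2 ^ t * M : ℕ) : ℝ) ^ (1 + ε) / ε ^ 3) :=
        mul_le_mul_of_nonneg_left (mul_one_add_log_pow_three_le_rpow hN1 hε hε1) hC.le
    _ = C * 4 ^ 3 * ((2 ^ t * M : ℕ) : ℝ) ^ (1 + ε) / ε ^ 3 := by ring

/-- **Mai–Murty's `(f, f) ≪ N (log N)³` for every level with `64 ∤ N` and squarefree odd part** —
in particular for the whole Frey–Hellegouarch class (`v₂(N) ∈ {0, 1, 3, 4, 5}`) — given the newform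
`g` of the twist `E^{(−1)}` at a level `N'` which, when `16 ∣ N`, has `16 ∤ N'` or equals `N`
(`N ∣ 16N'`, `N' ∣ 16N` always; the excluded configurations `v₂(N) = 4, v₂(N') = 5` and
`v₂(N) = 5, v₂(N') = 4` do not occur, by Atkin–Li, but that is not needed for the Frey–Hellegouarch
curves: `2⁴ ∥ N` exactly when the sign-swapped model `E^{(−1)}` is semistable at `2`, and `2⁵ ∥ N`
forces `N' = N`). Combines `exists_petersson_le_mul_log_cube_of_not_sixteen_dvd` (`16 ∤ N`),
`exists_petersson_le_mul_log_cube_of_quadraticTwist_neg_one` (`16 ∣ N`, `16 ∤ N'`; the odd part of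
`N'` is that of `N`) and `exists_petersson_le_mul_log_cube_of_two_pow_mul_five` (`N' = N = 2ᵗM`,
`t ∈ {4, 5}`). [cite: MaiMurty1994, §2, Proposition] -/
theorem exists_petersson_le_mul_log_cube_of_not_sixtyfour_dvd :
    ∃ C : ℝ, 0 < C ∧ ∀ (N N' : ℕ) [NeZero N] [NeZero N'], ¬ 64 ∣ N →
      (∀ p : ℕ, p.Prime → p ≠ 2 → ¬ p ^ 2 ∣ N) → (16 ∣ N → ¬ 16 ∣ N' ∨ N' = N) →
      ∀ (W : WeierstrassCurve ℚ) [W.IsElliptic] (f : CuspForm (Gamma0 N) 2)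
        (g : CuspForm (Gamma0 N') 2), IsNewformOf W f → IsNewformOf (W.quadraticTwist (-1)) g →
        (peterssonProduct (Gamma0 N) 2 f f).re ≤ C * N * (1 + Real.log N) ^ 3 := by
  obtain ⟨C₁, hC₁, h₁⟩ := exists_petersson_le_mul_log_cube_of_not_sixteen_dvd
  obtain ⟨C₂, hC₂, h₂⟩ := exists_petersson_le_mul_log_cube_of_quadraticTwist_neg_one
  obtain ⟨C₃, hC₃, h₃⟩ := exists_petersson_le_mul_log_cube_of_two_pow_mul_five
  refine ⟨max C₁ (max C₂ C₃), lt_max_of_lt_left hC₁, ?_⟩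
  intro N N' _ _ h64 hodd halt W _ f g hf hg
  have hN1 : (1 : ℝ) ≤ N := by exact_mod_cast NeZero.one_le (n := N)
  have hx0 : 0 ≤ (N : ℝ) * (1 + Real.log N) ^ 3 := by
    have := Real.log_nonneg hN1
    positivity
  have hmax1 : C₁ ≤ max C₁ (max C₂ C₃) := le_max_left _ _
  have hmax2 : C₂ ≤ max C₁ (max C₂ C₃) := (le_max_left _ _).trans (le_max_right _ _)
  have hmax3 : C₃ ≤ max C₁ (max C₂ C₃) := (le_max_right _ _).trans (le_max_right _ _)
  by_cases h16 : 16 ∣ N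
  · rcases halt h16 with h16' | hNN
    · -- the odd part of `N'` is that of `N` (`N' ∣ 16 N`)
      haveI : (W.quadraticTwist (-1 : ℚ)).IsElliptic := W.isElliptic_quadraticTwist (by norm_num)
      obtain ⟨-, -, hN'N⟩ := re_peterssonProduct_le_of_quadraticTwist_neg_one hf hg h16
      have hodd' : ∀ p : ℕ, p.Prime → p ≠ 2 → ¬ p ^ 2 ∣ N' := by
        intro p hp hp2 h
        have hpo : Odd p := hp.odd_of_ne_two hp2
        have hcop : Nat.Coprime (p ^ 2) 16 := by
          have : Nat.Coprime p 2 := Nat.coprime_two_right.mpr hpo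
          simpa using (this.pow 2 4)
        exact hodd p hp hp2 (hcop.dvd_of_dvd_mul_left (h.trans hN'N))
      calc (peterssonProduct (Gamma0 N) 2 f f).re ≤ C₂ * N * (1 + Real.log N) ^ 3 :=
            h₂ N N' h16 h16' hodd' W f g hf hg
        _ = C₂ * (N * (1 + Real.log N) ^ 3) := by ring
        _ ≤ max C₁ (max C₂ C₃) * (N * (1 + Real.log N) ^ 3) := mul_le_mul_of_nonneg_right hmax2 hx0
        _ = max C₁ (max C₂ C₃) * N * (1 + Real.log N) ^ 3 := by ring
    · have hg' : ∃ g' : CuspForm (Gamma0 N) 2, IsNewformOf (W.quadraticTwist (-1)) g' := by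
        subst hNN; exact ⟨g, hg⟩
      clear hg g
      obtain ⟨g, hg⟩ := hg'
      obtain ⟨t, M, hMo, hNtM⟩ := Nat.exists_eq_two_pow_mul_odd (NeZero.ne N)
      subst hNtM
      haveI : NeZero M := ⟨fun h ↦ by rw [h] at hMo; exact (Nat.not_even_iff_odd.mpr hMo) (Even.zero)⟩
      have hMs : Squarefree M := by
        refine Nat.squarefree_iff_prime_squarefree.mpr fun p hp hpp ↦ ?_
        have hp2 : p ≠ 2 := by
          rintro rfl
          exact (Nat.not_even_iff_odd.mpr hMo) (even_iff_two_dvd.mpr ((dvd_mul_right 2 2).trans hpp))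
        exact hodd p hp hp2 (by rw [sq]; exact hpp.trans (Dvd.intro_left _ rfl))
      have ht5 : t ≤ 5 := by
        by_contra h
        obtain ⟨k, rfl⟩ := Nat.exists_eq_add_of_le (by omega : 6 ≤ t)
        exact h64 ⟨2 ^ k * M, by rw [pow_add]; ring⟩
      have ht4 : 4 ≤ t := by
        by_contra h
        have hcop : Nat.Coprime (2 ^ 4) M := (Nat.coprime_two_left.mpr hMo).pow_left 4
        have h16M : 2 ^ 4 ∣ 2 ^ t * M := by simpa using h16
        have := (Nat.Coprime.dvd_mul_right hcop).mp h16M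
        have := Nat.pow_dvd_pow_iff_le_right (by norm_num : 1 < 2) |>.mp this
        omega
      calc (peterssonProduct (Gamma0 (2 ^ t * M)) 2 f f).re
          ≤ C₃ * (2 ^ t * M : ℕ) * (1 + Real.log (2 ^ t * M : ℕ)) ^ 3 :=
            h₃ t M (by omega) ht5 hMo hMs W f g hf hg
        _ = C₃ * ((2 ^ t * M : ℕ) * (1 + Real.log (2 ^ t * M : ℕ)) ^ 3) := by ring
        _ ≤ max C₁ (max C₂ C₃) * ((2 ^ t * M : ℕ) * (1 + Real.log (2 ^ t * M : ℕ)) ^ 3) :=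
            mul_le_mul_of_nonneg_right hmax3 hx0
        _ = max C₁ (max C₂ C₃) * (2 ^ t * M : ℕ) * (1 + Real.log (2 ^ t * M : ℕ)) ^ 3 := by ring
  · calc (peterssonProduct (Gamma0 N) 2 f f).re ≤ C₁ * N * (1 + Real.log N) ^ 3 :=
          h₁ N h16 hodd W f hf
      _ = C₁ * (N * (1 + Real.log N) ^ 3) := by ring
      _ ≤ max C₁ (max C₂ C₃) * (N * (1 + Real.log N) ^ 3) := mul_le_mul_of_nonneg_right hmax1 hx0
      _ = max C₁ (max C₂ C₃) * N * (1 + Real.log N) ^ 3 := by ring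

/-- **Power form** of `exists_petersson_le_mul_log_cube_of_not_sixtyfour_dvd` (the shape consumed by
the `abc` routes): `Re (f, f) ≤ C · N^{1+ε}/ε³` for `0 < ε ≤ 1`. [cite: MaiMurty1994, §2, Proposition] -/
theorem exists_petersson_le_mul_rpow_of_not_sixtyfour_dvd :
    ∃ C : ℝ, 0 < C ∧ ∀ ε : ℝ, 0 < ε → ε ≤ 1 → ∀ (N N' : ℕ) [NeZero N] [NeZero N'], ¬ 64 ∣ N →
      (∀ p : ℕ, p.Prime → p ≠ 2 → ¬ p ^ 2 ∣ N) → (16 ∣ N → ¬ 16 ∣ N' ∨ N' = N) →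
      ∀ (W : WeierstrassCurve ℚ) [W.IsElliptic] (f : CuspForm (Gamma0 N) 2)
        (g : CuspForm (Gamma0 N') 2), IsNewformOf W f → IsNewformOf (W.quadraticTwist (-1)) g →
        (peterssonProduct (Gamma0 N) 2 f f).re ≤ C * (N : ℝ) ^ (1 + ε) / ε ^ 3 := by
  obtain ⟨C, hC, h⟩ := exists_petersson_le_mul_log_cube_of_not_sixtyfour_dvd
  refine ⟨C * 4 ^ 3, by positivity, fun ε hε hε1 N N' _ _ h64 hodd halt W _ f g hf hg ↦ ?_⟩
  have hN1 : (1 : ℝ) ≤ N := by exact_mod_cast NeZero.one_le (n := N)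
  calc (peterssonProduct (Gamma0 N) 2 f f).re ≤ C * N * (1 + Real.log N) ^ 3 :=
        h N N' h64 hodd halt W f g hf hg
    _ = C * (N * (1 + Real.log N) ^ 3) := by ring
    _ ≤ C * (4 ^ 3 * (N : ℝ) ^ (1 + ε) / ε ^ 3) :=
        mul_le_mul_of_nonneg_left (mul_one_add_log_pow_three_le_rpow hN1 hε hε1) hC.le
    _ = C * 4 ^ 3 * (N : ℝ) ^ (1 + ε) / ε ^ 3 := by ring

end MainFive

/-! ### The level of the twisted newform divides `lcm(level, conductor²)` (Atkin–Li); the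
configurations `v₂(N) = 4, v₂(N') = 5` and `v₂(N) = 5, v₂(N') = 4` do not occur -/

section LevelLcm

variable {N : ℕ} [NeZero N] {k : ℤ} {m : ℕ} [NeZero m] {L : ℕ}

/-- **Level support of the twisted newform, in the sharp form `N ∣ lcm(M, m²)`.**  Let
`f ∈ S_k(Γ₀(N))` be a newform, `ψ mod m` primitive quadratic, and `g ∈ S_k(Γ₀(M))` a newform with
`a_p(g) = ψ(p) a_p(f)` for all primes `p ∤ L` (`L ≠ 0`).  Then `N ∣ lcm(M, m²)`: the twist of `g` by
`ψ` lives on `Γ₀(lcm(M, m²))` (Shimura 1971, Prop. 3.64: the tree's `charTwist` at any common multiple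
of the level and `m²`), so its packet is that of a newform `g₁` of level `M₁ ∣ lcm(M, m²)`
(`exists_isNewform0_cuspCoeff_eq_charTwist`), and `a_p(g₁) = ψ(p)² a_p(f) = a_p(f)` for almost all
`p`, whence `M₁ = N` by strong multiplicity one across levels (Atkin–Lehner 1970, Thm. 4;
`IsNewform0.level_eq_of_heckeEigenvalue_eq_holds`).  The tree's
`level_dvd_mul_sq_of_charTwist_packet` is the same argument at the common multiple `M m²`; the `lcm`
is what excludes, for `m = 4`, a drop or rise of the `2`-level between `2⁴` and `2⁵` under a twist by
`χ₄` (Atkin–Li 1978, Thm. 3.1: twisting by a character of conductor `2²` preserves the exact level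
`2⁵ ∥ N`). [cite: AtkinLi1978, §3] [cite: AtkinLehner1970, Thm. 4] -/
theorem level_dvd_lcm_sq_of_charTwist_packet {ψ : DirichletCharacter ℂ m} (hψ : ψ.IsQuadratic)
    (hprim : ψ.IsPrimitive) {f : CuspForm (Gamma0 N) k} (hf : IsNewform0 f)
    {M : ℕ} [NeZero M] {g : CuspForm (Gamma0 M) k} (hg : IsNewform0 g)
    (hpk : ∀ p : ℕ, p.Prime → ¬ p ∣ L → cuspCoeff g p = ψ p * cuspCoeff f p) (hL : L ≠ 0) :
    N ∣ Nat.lcm M (m ^ 2) := by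
  have hL'0 : Nat.lcm M (m ^ 2) ≠ 0 := Nat.lcm_ne_zero (NeZero.ne M) (pow_ne_zero 2 (NeZero.ne m))
  haveI : NeZero (Nat.lcm M (m ^ 2)) := ⟨hL'0⟩
  obtain ⟨M₁, _, hM₁, g₁, hg₁, hpk₁⟩ := exists_isNewform0_cuspCoeff_eq_charTwist (Nat.lcm M (m ^ 2))
    (Nat.dvd_lcm_left M _) (Nat.dvd_lcm_right M _) hψ hprim hg
  -- `g₁` and `f` have the same Hecke eigenvalues at the primes `p ∤ L · lcm(M, m²)`
  have hfin : {p : ℕ | p.Prime ∧ heckeEigenvalue g₁ p ≠ heckeEigenvalue f p}.Finite := by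
    refine (L * Nat.lcm M (m ^ 2)).primeFactors.finite_toSet.subset ?_
    rintro p ⟨hp, hne⟩
    rw [Finset.mem_coe, Nat.mem_primeFactors]
    refine ⟨hp, ?_, mul_ne_zero hL hL'0⟩
    by_contra hndvd
    have hpL : ¬ p ∣ L := fun h ↦ hndvd (dvd_mul_of_dvd_left h _)
    have hpL' : ¬ p ∣ Nat.lcm M (m ^ 2) := fun h ↦ hndvd (dvd_mul_of_dvd_right h _)
    have hpm : ¬ p ∣ m := fun h ↦
      hpL' ((h.trans (dvd_pow_self m two_ne_zero)).trans (Nat.dvd_lcm_right M _))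
    have hunit : IsUnit ((p : ℕ) : ZMod m) := (ZMod.isUnit_prime_iff_not_dvd hp).mpr hpm
    have hsq : ψ p ^ 2 = 1 := apply_sq_eq_one_of_isQuadratic hψ hunit
    apply hne
    rw [heckeEigenvalue_eq_coeff_of_isNormalized hg₁.2.2 hp (hg₁.2.1 p hp),
      heckeEigenvalue_eq_coeff_of_isNormalized hf.2.2 hp (hf.2.1 p hp)]
    change cuspCoeff g₁ p = cuspCoeff f p
    rw [hpk₁ p hp hpL', hpk p hp hpL]
    linear_combination cuspCoeff f p * hsq
  have hN₁ : M₁ = N := IsNewform0.level_eq_of_heckeEigenvalue_eq_holds hg₁ hf hfin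
  rw [← hN₁]
  exact hM₁

end LevelLcm

section TwistLevel

variable {N N' : ℕ} [NeZero N] [NeZero N'] {W : WeierstrassCurve ℚ} [W.IsElliptic]

/-- **The levels of the newforms of `E` and of `E^{(−1)}` divide `lcm(·, 16)` of each other.**  For
the newform `f ∈ S₂(Γ₀(N))` of `E/ℚ` and the newform `g ∈ S₂(Γ₀(N'))` of the twist `E^{(−1)}`
(`a_p(g) = χ₄(p) a_p(f)` and `a_p(f) = χ₄(p) a_p(g)` for odd primes `p`):
`N ∣ lcm(N', 16)` and `N' ∣ lcm(N, 16)` (`level_dvd_lcm_sq_of_charTwist_packet` with `m = 4`, both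
ways).  In particular the odd parts of `N` and `N'` agree, `v₂(N') ≤ max(v₂(N), 4)` and
`v₂(N) ≤ max(v₂(N'), 4)`. [cite: AtkinLi1978, §3] -/
theorem _root_.Literature.NumberTheory.EllipticCurves.ModularForms.IsNewformOf.level_dvd_lcm_sixteen_of_quadraticTwist_neg_one
    {f : CuspForm (Gamma0 N) 2} {g : CuspForm (Gamma0 N') 2} (hf : IsNewformOf W f)
    (hg : IsNewformOf (W.quadraticTwist (-1)) g) :
    N ∣ Nat.lcm N' 16 ∧ N' ∣ Nat.lcm N 16 := by
  set χ : DirichletCharacter ℂ 4 := ZMod.χ₄.ringHomComp (Int.castRingHom ℂ) with hχ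
  have hχq : χ.IsQuadratic := isQuadratic_χ₄_ringHomComp
  have hχp : χ.IsPrimitive := isPrimitive_χ₄_ringHomComp
  have hpk : ∀ p : ℕ, p.Prime → ¬ p ∣ 2 → cuspCoeff g p = χ p * cuspCoeff f p :=
    fun p hp hp2 ↦ IsNewformOf.cuspCoeff_prime_eq_χ₄_mul hf hg p hp hp2
  have hpk' : ∀ p : ℕ, p.Prime → ¬ p ∣ 2 → cuspCoeff f p = χ p * cuspCoeff g p := by
    intro p hp hp2
    have hodd : ¬ 2 ∣ p := by
      intro h
      obtain rfl : 2 = p := (Nat.prime_dvd_prime_iff_eq Nat.prime_two hp).mp h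
      exact hp2 dvd_rfl
    have h1 : χ p * χ p = 1 := by
      rw [hχ, χ₄_ringHomComp_apply_natCast, ← Int.cast_mul, ← sq, χ₄_sq_eq_one_of_odd hodd,
        Int.cast_one]
    rw [hpk p hp hp2, ← mul_assoc, h1, one_mul]
  have h1 : N ∣ Nat.lcm N' (4 ^ 2) :=
    level_dvd_lcm_sq_of_charTwist_packet hχq hχp hf.1 hg.1 hpk two_ne_zero
  have h2 : N' ∣ Nat.lcm N (4 ^ 2) :=
    level_dvd_lcm_sq_of_charTwist_packet hχq hχp hg.1 hf.1 hpk' two_ne_zero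
  exact ⟨by simpa using h1, by simpa using h2⟩

/-- **No level drop between `2⁴` and `2⁵` under the twist by `−1`**: in the situation of
`IsNewformOf.level_dvd_lcm_sixteen_of_quadraticTwist_neg_one`, if `16 ∣ N` then either `16 ∤ N'` or
`N' = N` (if `16 ∣ N'` as well, `N ∣ lcm(N', 16) = N'` and `N' ∣ lcm(N, 16) = N`).  This is the
hypothesis of `exists_petersson_le_mul_log_cube_of_not_sixtyfour_dvd`, now a theorem. [cite: AtkinLi1978, §3] -/
theorem _root_.Literature.NumberTheory.EllipticCurves.ModularForms.IsNewformOf.not_sixteen_dvd_or_level_eq_of_quadraticTwist_neg_one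
    {f : CuspForm (Gamma0 N) 2} {g : CuspForm (Gamma0 N') 2} (hf : IsNewformOf W f)
    (hg : IsNewformOf (W.quadraticTwist (-1)) g) (h16 : 16 ∣ N) : ¬ 16 ∣ N' ∨ N' = N := by
  obtain ⟨h1, h2⟩ := hf.level_dvd_lcm_sixteen_of_quadraticTwist_neg_one hg
  by_cases h16' : 16 ∣ N'
  · right
    rw [Nat.lcm_eq_left h16'] at h1
    rw [Nat.lcm_eq_left h16] at h2
    exact Nat.dvd_antisymm h2 h1
  · exact Or.inl h16'

/-- **Mai–Murty's `(f, f) ≪ N (log N)³` for every level with `64 ∤ N` and squarefree odd part —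
unconditionally in the level `N'` of the newform of the twist.**  There is an absolute `C > 0` such
that for every `N` with `64 ∤ N` and `p² ∤ N` for all odd primes `p` (in particular every conductor of
a Frey–Hellegouarch curve `y² = x(x − a)(x + b)`, `v₂(N) ∈ {0, 1, 3, 4, 5}`), every elliptic curve
`E/ℚ` with newform `f ∈ S₂(Γ₀(N))` (`IsNewformOf E f`) and any newform `g` of the twist `E^{(−1)}`
(at any level `N'`; `IsNewformOf E^{(−1)} g` — modularity of the twisted curve),
`Re (f, f)_{Γ₀(N)} ≤ C · N · (1 + log N)³`.  This is
`exists_petersson_le_mul_log_cube_of_not_sixtyfour_dvd` with its level hypothesis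
`16 ∣ N → 16 ∤ N' ∨ N' = N` discharged by
`IsNewformOf.not_sixteen_dvd_or_level_eq_of_quadraticTwist_neg_one` (Atkin–Li). The statement is
the one the printed proof of the named fact `murty_petersson_newform_upper_bound` establishes
(Mai–Murty 1994, §2: `L(1, Sym² f) = O((log N)³)` by Rademacher's Phragmén–Lindelöf, and
Rankin–Selberg), here for the whole class of curves of the `abc` routes (semistable, or
Frey–Hellegouarch). [cite: MaiMurty1994, §2, Proposition] [cite: AtkinLi1978, §3] -/
theorem exists_petersson_le_mul_log_cube_of_not_sixtyfour_dvd' :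
    ∃ C : ℝ, 0 < C ∧ ∀ (N N' : ℕ) [NeZero N] [NeZero N'], ¬ 64 ∣ N →
      (∀ p : ℕ, p.Prime → p ≠ 2 → ¬ p ^ 2 ∣ N) →
      ∀ (W : WeierstrassCurve ℚ) [W.IsElliptic] (f : CuspForm (Gamma0 N) 2)
        (g : CuspForm (Gamma0 N') 2), IsNewformOf W f → IsNewformOf (W.quadraticTwist (-1)) g →
        (peterssonProduct (Gamma0 N) 2 f f).re ≤ C * N * (1 + Real.log N) ^ 3 := by
  obtain ⟨C, hC, h⟩ := exists_petersson_le_mul_log_cube_of_not_sixtyfour_dvd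
  exact ⟨C, hC, fun N N' _ _ h64 hodd W _ f g hf hg ↦ h N N' h64 hodd
    (fun h16 ↦ hf.not_sixteen_dvd_or_level_eq_of_quadraticTwist_neg_one hg h16) W f g hf hg⟩

/-- **Power form** of `exists_petersson_le_mul_log_cube_of_not_sixtyfour_dvd'` (the shape consumed by
the `abc` routes, no hypothesis on `N'`): `Re (f, f) ≤ C · N^{1+ε}/ε³` for `0 < ε ≤ 1`.
[cite: MaiMurty1994, §2, Proposition] -/
theorem exists_petersson_le_mul_rpow_of_not_sixtyfour_dvd' :
    ∃ C : ℝ, 0 < C ∧ ∀ ε : ℝ, 0 < ε → ε ≤ 1 → ∀ (N N' : ℕ) [NeZero N] [NeZero N'], ¬ 64 ∣ N →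
      (∀ p : ℕ, p.Prime → p ≠ 2 → ¬ p ^ 2 ∣ N) →
      ∀ (W : WeierstrassCurve ℚ) [W.IsElliptic] (f : CuspForm (Gamma0 N) 2)
        (g : CuspForm (Gamma0 N') 2), IsNewformOf W f → IsNewformOf (W.quadraticTwist (-1)) g →
        (peterssonProduct (Gamma0 N) 2 f f).re ≤ C * (N : ℝ) ^ (1 + ε) / ε ^ 3 := by
  obtain ⟨C, hC, h⟩ := exists_petersson_le_mul_rpow_of_not_sixtyfour_dvd
  exact ⟨C, hC, fun ε hε hε1 N N' _ _ h64 hodd W _ f g hf hg ↦ h ε hε hε1 N N' h64 hodd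
    (fun h16 ↦ hf.not_sixteen_dvd_or_level_eq_of_quadraticTwist_neg_one hg h16) W f g hf hg⟩

/-- **Logarithmic form**: `log Re (f, f) ≤ log N + 3 log (1 + log N) + log C` under the hypotheses of
`exists_petersson_le_mul_log_cube_of_not_sixtyfour_dvd'` (when `Re (f, f) > 0`; for `Re (f,f) = 0`
the left side is `log 0 = 0` in Mathlib's convention and the bound is applied only with
`0 < Re (f, f)`). Pasten's use of the named fact (arXiv:1705.09251, §16 p. 49:
"`2 log ‖f‖ ≤ log N + O(log log N)`"). [cite: PastenShimura2024, §16 p. 49] [cite: MaiMurty1994, §2, Proposition] -/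
theorem exists_log_petersson_le_of_not_sixtyfour_dvd :
    ∃ C : ℝ, ∀ (N N' : ℕ) [NeZero N] [NeZero N'], ¬ 64 ∣ N →
      (∀ p : ℕ, p.Prime → p ≠ 2 → ¬ p ^ 2 ∣ N) →
      ∀ (W : WeierstrassCurve ℚ) [W.IsElliptic] (f : CuspForm (Gamma0 N) 2)
        (g : CuspForm (Gamma0 N') 2), IsNewformOf W f → IsNewformOf (W.quadraticTwist (-1)) g →
        0 < (peterssonProduct (Gamma0 N) 2 f f).re →
        Real.log (peterssonProduct (Gamma0 N) 2 f f).re ≤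
          Real.log N + 3 * Real.log (1 + Real.log N) + C := by
  obtain ⟨C, hC, h⟩ := exists_petersson_le_mul_log_cube_of_not_sixtyfour_dvd'
  refine ⟨Real.log C, fun N N' _ _ h64 hodd W _ f g hf hg hpos ↦ ?_⟩
  have hN0 : (0 : ℝ) < N := Nat.cast_pos.mpr (NeZero.pos N)
  have hN1 : (1 : ℝ) ≤ N := by exact_mod_cast NeZero.one_le (n := N)
  have hl : 0 < 1 + Real.log N := by
    have := Real.log_nonneg hN1
    linarith
  have hb := h N N' h64 hodd W f g hf hg
  calc Real.log (peterssonProduct (Gamma0 N) 2 f f).re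
      ≤ Real.log (C * N * (1 + Real.log N) ^ 3) := Real.log_le_log hpos hb
    _ = Real.log N + 3 * Real.log (1 + Real.log N) + Real.log C := by
        rw [Real.log_mul (by positivity) (by positivity), Real.log_mul hC.ne' hN0.ne',
          Real.log_pow]
        push_cast
        ring

end TwistLevel

end Literature.NumberTheory.Automorphic

end
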